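/-
Copyright: lit-balaban Phase-2 proof seat p29 (gen 29).  Statement-level skeleton of a published paper; no proof claims beyond what the
kernel checks below.
-/
import Literature.MathematicalPhysics.QuantumFieldTheory.BalabanImbrieJaffe1984to88.BIJ88NeumannPropagatorSmallFieldCubeHolderDecay
import Literature.MathematicalPhysics.QuantumFieldTheory.BalabanImbrieJaffe1984to88.BIJ88LocDeriv230SmallFieldOpTorus
import Literature.MathematicalPhysics.QuantumFieldTheory.BalabanImbrieJaffe1984to88.BIJ88LocDerivHolder230FlatTorus

/-!
# `BalabanImbrieJaffe1984to88.BIJ88LocDerivHolder230SmallFieldTorus` — T. Bałaban, J. Imbrie, A. Jaffe, *Effective action and cluster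
properties of the abelian Higgs model*, Commun. Math. Phys. **114** (1988) 257–315 [BalabanImbrieJaffe1988], Sect. 2 p. 263 [PDF 7], the
sentence after (2.33): *"Bounds analogous to (2.30), (2.31) hold for covariant derivatives and Hölder derivatives of G_{k,loc}(u) of order less
than two"* — **THE MEMBER OF TOP ORDER `1 + θ` (`0 ≤ θ < 1`) OF (2.30) AT NON-FLAT SMALL FIELDS `u`: THE HÖLDER QUOTIENT OF THE COVARIANT
DERIVATIVE OF `G_{k,loc}(u)f`, TRANSPORTED ALONG [6]'s SHORTEST CONTOUR, `k`-UNIFORM, FOR THE PRINTED LOCALIZATION DATA** (the torus cubes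
`{□_α}`, the weights `λ_α` of (2.27) of gen 26's `BIJ88LocWeights227Torus`, a smooth cut-off `ζ″` — instance: r18's product cut-off
`ζ^Π(R₁, R₀)` of (2.29)) — the non-flat companion of gen 28's pure-gauge file `BIJ88LocDerivHolder230FlatTorus` (same four-term mechanism), made
possible by p27 gen 35's [6] (1.9) member for the cube propagators at small `u` (`BIJ88NeumannPropagatorSmallFieldCubeHolderDecay`, p351875) and
p34 gen 17's `k`-uniform (1.10) derivative member (`BIJ88NeumannPropagatorSmallFieldCubeDeriv`).

statement-level skeleton of published theorems with citation tags; proofs where landed; nothing here is a claim about the Yang–Mills mass gap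

PDF held: `paper:balaban1988-cmp114-bij-abelian-higgs-effective-action` (journal page = PDF page + 256); p. 263 [PDF 7] re-read this session on
the page render `run/shared/lean/pub/lit-balaban/lit-balaban-p31/renders/original-p007-x2.png`; [6] = [Balaban1983RegularityDecay] p. 573
(Theorem, (1.9): *"|(D^η_{A,μ}G_k(Ω,A)f)(x) − U(A(Γ_{x,x′}))(D^η_{A,μ}G_k(Ω,A)f)(x′)| ≦ c₀|x − x′|^α exp(−δ₀dist({x,x′}, supp f))‖f‖_∞"*,
*"Γ_{x,x′} a shortest contour"*) re-read from the text layer of `paper:balaban1983-cmp89-regularity-decay` p. 3.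

CITATION HEADER (lean-in-tree rule).  Part of the lit-balaban TYPED SKELETON (HOME `run/shared/lean/pub/lit-balaban/`), PHASE-2 proof seat
p29 gen 29 (unit `lit-balaban-p29-g29`; TAKING line HOME/STATUS.md 2026-08-23T04:42:55Z — own lineage: gen 28's HONEST SCOPE *"the 1 + θ
member at non-flat u needs [6] (1.9) for cubes at non-flat u"*, p27 g35's 04:11Z hand-over of `holder19_smallField_cube_input`, r18 g24's
closure book (γ′) *"order-(1+θ) Hölder member for G_{k,loc}(u) at non-flat u (nobody)"*; r18 g25 holds the disjoint REGULAR-`u` twin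
`BIJ88LocDerivHolder230RegularTorus`; free-target protocol G.5-34(d)).  Rows **C2.Claim@263** / **C2.Eq2.30** (owner r18; the abstract
hence-step is p08's `BIJ88HolderDecay230`, unchanged).  Kind: theorems only (no definition, no `Prop`-valued fact; p27's / p34's / p30's /
gen 26–29's declarations used BY NAME).

THE PRINTED TEXT (p. 263, verbatim and IN PRINT ORDER; (2.29) precedes — v1.1 doc-only correction, referee ref-5 D-g65-4 / D-g66-1: the
earlier header re-ordered the page, inserted the non-printed connective «Hence the following estimates hold» and dropped the leading constant
`c` of (2.30); re-read on the page image `lit-balaban-p31/renders/original-p007-x2.png`; declarations unchanged).  *"The boundary conditions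
are always at a distance O(r(e_k)) from x₁, x₂, so a straightforward application of the random walk expansion of [6] shows that
|(G_{k,loc}(u)f)(x)| ≦ ce^{−c dist(suppt f,x)}‖f‖_∞, (2.30) |(G_{k,loc}(u)f − G_k(Ω,u)f)(x)| ≦ e^{−cr(e_k)}e^{−c dist(suppt f,x)}‖f‖_∞, (2.31)
for dist(x, Ω^c) ≧ O(r(e_k)). [Each G_k(□_α,u) is close to G_k(Ω,u) for the relevant x₁, x₂, therefore the convex combination and G_{k,loc}
are close also.] We assume that u is smooth in the □_α's entering the sum in (2.27); for (2.31) we assume smoothness throughout the subset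
Ω ⊂ T_η. This means that in a neighborhood of each □_α there exists an A, λ such that u = exp[ie_kη(A + ∂λ)] with |∂A|, |∂*A| ≦ O(p(e_k)).
(2.32) … Bounds analogous to (2.30), (2.31) hold for covariant derivatives and Hölder derivatives of G_{k,loc}(u) of order less than two."*

THE MECHANISM (ours, declared — gen 28's four-term split at the non-flat `u`, transport = p30's staircase holonomy `stairHol u x₁ x₂`).  NEAR
PAIRS `|x₁ − x₂|_T ≤ L^k`: by gen 27's bond identity `covD_gLocT_apply` at both bonds,
`U(Γ)(D_uG_{k,loc}f)(x₂,μ) − (D_uG_{k,loc}f)(x₁,μ) = Σ_α[A_α + B_α] + Σ_α[C_α + D_α]` with (A) `U(Γ)(D_uG_αg′)(x₂,μ) − (D_uG_αg′)(x₁,μ)` for the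
FIXED row source `g′ = ζ″(x₂+e_μ,·)λ_α(x₂+e_μ,·)f` — p27's `holder19_smallField_cube_input` ([6] (1.9) for `G_k(□_α,u)`, both points with their
`3L^k`-balls inside `□_α`: a cube active at `x₂ + e_μ` contains every point of `Ω₀` within `R > 4L^k + 1` of it (gen 26's row hypothesis (ii)) and
the balls stay in `Ω₀` by the chart depth `R₀ ≥ 3L^k`); (B) `(D_uG_α(g′_{x₂+e_μ} − g′_{x₁+e_μ}))(x₁,μ)` — p34's `decay110_smallField_cube_deriv`
(bond `L^k`-deep in `□_α`) on a source of size `≤ Λ₁(d+1)|x₁ − x₂|_T‖f‖_∞` (gen 28's `abs_weight_shift_sub_le_of_hull` along the chart hull);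
(C) `ε⁻¹[U(Γ)ψ(x₂) − ψ(x₁)]`, `ψ = G_αδg_{x₂}` the cube propagator of the bond-difference source of `x₂` — TELESCOPED BOND BY BOND ALONG THE
STAIRCASE (§1 `norm_stairHol_mul_sub_le_of_near`: `‖U(Γ)ψ(x₂) − ψ(x₁)‖ ≤ ε·B·(d+1)|x₁ − x₂|_∞` when every bond `⟨w, w+e_m⟩` with `w` within
`|x₁ − x₂|_∞` of both ends has `‖(D_uψ)(w,m)‖ ≤ B`; §2: the staircase's sites ARE within `|x₁ − x₂|_∞` of both ends), each bond by p34's member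
at support distance `≥ D − L^k` (the staircase sites are `L^k`-deep in `□_α`: chart depth `≥ R₀ − L^k ≥ 2L^k`, distance `≥ R − L^k − 1 ≥ L^k`
from the part of `Ω₀` outside the cube); (D) `ε⁻¹(G_α(δg_{x₂} − δg_{x₁}))(x₁)` — p27's value member `decay110_smallField_cube` on a SECOND
difference of the row weights, `≤ Λ₂(d+1)|x₁ − x₂|_T‖f‖_∞` (gen 28's `abs_weight_bondDiff_sub_le_of_hull`), `ε⁻¹(L^kε)² = (L^kε)L^k`.  The
weight `(L^k/|x₁ − x₂|_T)^θ` is spent as `w·|x₁ − x₂|_T ≤ L^k` on (B)(C)(D) and absorbed as `L^kΛ₁ ≤ Λ₀(1 + L^k((R₀−R₁)⁻¹ + s⁻¹))`,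
`L^{2k}Λ₂ ≤ Λ₀₂(1 + L^k(…))²`; `≤ m, 2m, 2m, 4m` active labels.  FAR PAIRS: `w ≤ 1`, two covariant-derivative members (gen 29's
`deriv230_smallField_op_of_lipschitz`), `|U(Γ)| = 1`.  Coincident points: `stairHol u x x = 1` (§3 `stairHol_self`).

WHAT IS PROVED (theorems only; 0 `sorry`; standard axioms).
* §1 `norm_axisHol_mul_sub_le`, `norm_legHol_mul_sub_le`, **`norm_stairHol_mul_sub_le`** — telescoping of `U(Γ_{x₀,x₁})ψ(x₁) − ψ(x₀)` along
  p30's staircase: `≤ |c′|⁻¹·B·(d+1)|x₀ − x₁|_∞` given a bound `B` on `‖D^{c′}_uψ‖` at the staircase bonds.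
* §2 `supDist_run_fwd_le`, `supDist_run_bwd_le`, **`norm_stairHol_mul_sub_le_of_near`** — the run points of every leg stay within `|x₀ − x₁|_∞`
  of both end points, so the bond bound is only needed there.
* §3 `stairHol_self`; **`derivHolder230_smallField_of_smooth`** — for `d + 1 ∈ {2,3}`, `L` odd `> 1`, `a > 0`, `0 ≤ θ < 1`, `K₁, K₂ ≥ 0` THERE
  EXIST `t₀, c₀ > 0` depending on `(d, L, a, θ, K₁, K₂)` only such that for every volume (`P.d = d+1`, `P.L = L`), every `1 ≤ k ≤ K_P`, every
  no-wrap box `Ω₀ = c·L^k + Π_i[0, L^kM₀_i)` shorter than the torus with torus gap `≥ R`, `s ≥ 1`, `W ≥ 2s/3 + R₀/2 + R`, `4L^k + 1 < R`,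
  `0 ≤ R₁ < R₀`, `3L^k ≤ R₀`, every real cut-off `ζ″` (`|ζ″| ≤ 1`, `= 0` beyond `R₀`, first differences in `x` `≤ K₁/(R₀−R₁)`, second
  `≤ K₂/(R₀−R₁)²`), every `U(1)` field with `|u(∂p) − 1| ≤ θ_p` on the torus (`2(d+1)³(L^{2k}θ_p)² ≤ 1`) and bondwise small inside `Ω₀` (p27's
  `(T, δ)`: `2(L^k−1)L^k(d+1)T² + 2δ² ≤ 1/2`), every `μ`, all `x₁, x₂` with the four bond ends in `Ω₀` at chart depth `≥ R₀`, every `f`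
  (`‖f‖_∞ ≤ F`) supported at sup-torus distance `≥ D ≥ 0` from `x₁` and `x₂`:
  `(L^k/|x₁ − x₂|_T)^θ·‖U(Γ_{x₁,x₂})(D_uG_{k,loc}(u)f)(x₂,μ) − (D_uG_{k,loc}(u)f)(x₁,μ)‖ ≤ (L^kε)·c₀·m·(1 + L^k((R₀−R₁)⁻¹ + s⁻¹))²·e^{−t₀D/L^k}·F`,
  `m = (⌊(L^k − 1 + R₀)/s⌋ + 3)^{d+1}`.
* §4 **`derivHolder230_smallField_zetaPi`** — §3 for r18's `zetaPi R₁ R₀ 0` (`1 ≤ R₁ < R₀ ≤ (|T^{(0)}| − 3)/2`; `K₁ = C_σ`, `K₂ = C_σ² + C_σ` from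
  the universal profile bound of `Literature.Analysis.Calculus.exists_abs_deriv_and_deriv_deriv_smoothTransition_le`).
HONEST SCOPE / DIVERGENCE.  (i) `d + 1 ∈ {2, 3}`, `L` odd, `1 ≤ k ≤ K_P` — p27's/p34's hypotheses.  (ii) DEEP PAIRS ONLY and a larger collar
than gen 28's flat file: the four bond ends in `Ω₀` at chart depth `≥ R₀ ≥ 3L^k` and `R > 4L^k + 1` (p27's (1.9) input wants both `3L^k`-balls
inside the cube; print's (2.30) has no depth restriction; [6]'s parallelepiped remark is not in the tree).  (iii) The smallness of `u` is p27's
bondwise `(T, δ)` form INSIDE `Ω₀` plus p34's plaquette bound on the torus (print: *"u is smooth in the □_α's"*; the (7.3.1)-only variant via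
p27's `holder19_smallPlaquette_cube_uniform_input` is NOT done here).  (iv) SMOOTH cut-offs only (second differences needed for term (D)), §4 being
the member for r18's `zetaPi`; p13's `cutoff R₁ R₀ |·|_T` is merely Lipschitz on the lattice and is NOT covered (as in gen 28).  (v) (2.30)-analogue
only; the (2.31)-analogue of order `1 + θ` and the regular-`u` twin are other files (r18 g25).  (vi) The transport is p30's axis-by-axis
shortest staircase `stairHol` (one of [6]'s shortest contours), not an arbitrary shortest contour.  (vii) Constants explicit up to p27's/p34's
`(t₀, c)` and `C_σ`; not optimized; `set_option maxHeartbeats 800000` on §3 (elaboration budget only).  Imports: p27 gen 35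
`BIJ88NeumannPropagatorSmallFieldCubeHolderDecay` (→ p30 `BIJ85ScalarPropagatorHolderDecay`, p34), gen 29 `BIJ88LocDeriv230SmallFieldOpTorus`
(→ gen 26–29, p34, p31), gen 28 `BIJ88LocDerivHolder230FlatTorus` (§2 weight lemmas).  Literature + Mathlib only.  Unit `lit-balaban-p29`
(literature-prover-lit-balaban-p29-g29-0), 2026-08-23.  NOT summit progress.
-/

open scoped BigOperators Matrix ComplexConjugate
open Finset Matrix

namespace Literature.MathematicalPhysics.QuantumFieldTheory.BalabanImbrieJaffe1984to88.BIJ88LocDerivHolder230SmallFieldTorus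

open Literature.MathematicalPhysics.QuantumFieldTheory.Balaban1983to89
open LatticeFieldCalculus (supDist runSite runSite_zero runSite_succ)
open B3TorusRadialSums (cdist cdist_le_supDist supDist_comm supDist_eq_sup_cdist cdist_neg cdist_le_val)
open BIJ88Sect3Statements (U1 toC cfg covD starB mem_starB norm_toC toC_one toC_mul toC_inv)
open BIJ88NeumannPropagator227Torus (conj_mul_toC)
open BIJ85ScalarPropagatorHolderDecay (axisHol axisHol_zero axisHol_succ runSite_apply_self runSite_apply_ne stairPt stairPt_zero stairPt_of_le
  stairPt_succ_eq_runSite stairPt_eq_runSite_succ legHol stairHol stair_telescope norm_legHol min_val_le_supDist)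

noncomputable section

variable {P : Params} {j : ℕ}

/-! ## §1 Bond-level telescoping of the transported difference along p30's shortest staircase `Γ_{x₀,x₁}` -/

/-- **TELESCOPING ALONG A STRAIGHT SEGMENT** (`U([x, x+te_i])ψ(x + te_i) − ψ(x)` one bond at a time:
`U([x,x+(s+1)e_i])ψ(x+(s+1)e_i) − U([x,x+se_i])ψ(x+se_i) = U([x,x+se_i])·c′⁻¹(D^{c′}_uψ)(⟨x+se_i, i⟩)`, `|U| = 1`):
`‖U([x, x+te_i])ψ(x+te_i) − ψ(x)‖ ≤ |c′|⁻¹Σ_{s<t}‖(D^{c′}_uψ)(⟨x+se_i, i⟩)‖`. [cite: Balaban1983RegularityDecay, (1.9) p.573] -/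
theorem norm_axisHol_mul_sub_le (U : GaugeField P j U1) {c' : ℝ} (hc : c' ≠ 0) (ψ : Balaban1983to89.Site P j → ℂ) (i : Fin P.d)
    (x : Balaban1983to89.Site P j) :
    ∀ t : ℕ, ‖toC (axisHol U i t x) * ψ (runSite x i t) - ψ x‖ ≤ |c'|⁻¹ * ∑ s ∈ Finset.range t, ‖covD c' (cfg U) ψ ⟨runSite x i s, i⟩‖ := by
  intro t
  induction t with
  | zero => simp [toC_one]
  | succ t ih =>
      have hcC : (c' : ℂ) ≠ 0 := by exact_mod_cast hc
      have key : ∀ w : ℂ, ‖w‖ = |c'|⁻¹ * ‖(c' : ℂ) * w‖ := fun w => by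
        rw [norm_mul, Complex.norm_real, Real.norm_eq_abs, ← mul_assoc, inv_mul_cancel₀ (abs_ne_zero.2 hc), one_mul]
      have hstep : ‖toC (U ⟨runSite x i t, i⟩) * ψ (runSite x i (t + 1)) - ψ (runSite x i t)‖ =
          |c'|⁻¹ * ‖covD c' (cfg U) ψ ⟨runSite x i t, i⟩‖ := by
        rw [key, runSite_succ]
        simp only [covD, cfg]
        rfl
      calc ‖toC (axisHol U i (t + 1) x) * ψ (runSite x i (t + 1)) - ψ x‖
          = ‖toC (axisHol U i t x) * (toC (U ⟨runSite x i t, i⟩) * ψ (runSite x i (t + 1)) - ψ (runSite x i t)) +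
              (toC (axisHol U i t x) * ψ (runSite x i t) - ψ x)‖ := by
            rw [axisHol_succ, toC_mul]; ring_nf
        _ ≤ ‖toC (axisHol U i t x) * (toC (U ⟨runSite x i t, i⟩) * ψ (runSite x i (t + 1)) - ψ (runSite x i t))‖ +
              ‖toC (axisHol U i t x) * ψ (runSite x i t) - ψ x‖ := norm_add_le _ _
        _ ≤ |c'|⁻¹ * ‖covD c' (cfg U) ψ ⟨runSite x i t, i⟩‖ + |c'|⁻¹ * ∑ s ∈ Finset.range t, ‖covD c' (cfg U) ψ ⟨runSite x i s, i⟩‖ := by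
            refine add_le_add ?_ ih
            rw [norm_mul, norm_toC, one_mul, hstep]
        _ = |c'|⁻¹ * ∑ s ∈ Finset.range (t + 1), ‖covD c' (cfg U) ψ ⟨runSite x i s, i⟩‖ := by
            rw [Finset.sum_range_succ]; ring

/-- **TELESCOPING ONE LEG OF THE STAIRCASE, THE SHORT WAY ROUND** (`legHol` is the forward segment transport if the forward residue is the
short one, else the conjugate of the backward one; in the backward case `ū([w′,w])ψ(w) − ψ(w′)` has the norm of `U([w′,w])ψ(w′)·… ` read from
`w′ = stairPt (m+1)`): with `s_f = val(x₁,m − x₀,m)`, `s_b = val(x₀,m − x₁,m)`,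
`‖legHol_m·ψ(stairPt (m+1)) − ψ(stairPt m)‖ ≤ |c′|⁻¹·(Σ_{s<s_f}‖D_uψ(⟨stairPt m + se_m, m⟩)‖` if `s_f ≤ s_b`, else the same sum over the backward
segment from `stairPt (m+1)`). [cite: Balaban1983RegularityDecay, (1.9) p.573] -/
theorem norm_legHol_mul_sub_le (U : GaugeField P j U1) {c' : ℝ} (hc : c' ≠ 0) (ψ : Balaban1983to89.Site P j → ℂ)
    (x₀ x₁ : Balaban1983to89.Site P j) (m : Fin P.d) :
    ‖legHol U x₀ x₁ m.val * ψ (stairPt x₀ x₁ (m.val + 1)) - ψ (stairPt x₀ x₁ m.val)‖ ≤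
      |c'|⁻¹ * (if (x₁ m - x₀ m).val ≤ (x₀ m - x₁ m).val then
          ∑ s ∈ Finset.range (x₁ m - x₀ m).val, ‖covD c' (cfg U) ψ ⟨runSite (stairPt x₀ x₁ m.val) m s, m⟩‖
        else ∑ s ∈ Finset.range (x₀ m - x₁ m).val, ‖covD c' (cfg U) ψ ⟨runSite (stairPt x₀ x₁ (m.val + 1)) m s, m⟩‖) := by
  have hm : (⟨m.val, m.isLt⟩ : Fin P.d) = m := Fin.ext rfl
  unfold legHol
  rw [dif_pos m.isLt, hm]
  by_cases hle : (x₁ m - x₀ m).val ≤ (x₀ m - x₁ m).val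
  · rw [if_pos hle, if_pos hle]
    have h := norm_axisHol_mul_sub_le U hc ψ m (stairPt x₀ x₁ m.val) (x₁ m - x₀ m).val
    rw [← stairPt_succ_eq_runSite] at h
    exact h
  · rw [if_neg hle, if_neg hle]
    set a := toC (axisHol U m (x₀ m - x₁ m).val (stairPt x₀ x₁ (m.val + 1))) with hadef
    have ha : ‖a‖ = 1 := norm_toC _
    have h := norm_axisHol_mul_sub_le U hc ψ m (stairPt x₀ x₁ (m.val + 1)) (x₀ m - x₁ m).val
    rw [← stairPt_eq_runSite_succ, ← hadef] at h
    have e : (starRingEnd ℂ) a * ψ (stairPt x₀ x₁ (m.val + 1)) - ψ (stairPt x₀ x₁ m.val) =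
        -((starRingEnd ℂ) a * (a * ψ (stairPt x₀ x₁ m.val) - ψ (stairPt x₀ x₁ (m.val + 1)))) := by
      have h3 : (starRingEnd ℂ) a * a = 1 := by
        rw [← Complex.normSq_eq_conj_mul_self, ← Complex.sq_norm, ha]; norm_num
      calc (starRingEnd ℂ) a * ψ (stairPt x₀ x₁ (m.val + 1)) - ψ (stairPt x₀ x₁ m.val)
          = (starRingEnd ℂ) a * ψ (stairPt x₀ x₁ (m.val + 1)) - ((starRingEnd ℂ) a * a) * ψ (stairPt x₀ x₁ m.val) := by rw [h3, one_mul]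
        _ = _ := by ring
    rw [e, norm_neg, norm_mul, RCLike.norm_conj, ha, one_mul]
    exact h

/-- **TELESCOPING THE TRANSPORTED DIFFERENCE ALONG p30's SHORTEST STAIRCASE `Γ_{x₀,x₁}` FROM A UNIFORM BOND BOUND**: if
`‖(D^{c′}_uψ)(b)‖ ≤ B` for every bond `b` of the staircase (the bonds of the `d` legs, each run the short way round), then
`‖U(Γ_{x₀,x₁})ψ(x₁) − ψ(x₀)‖ ≤ |c′|⁻¹·B·d·|x₀ − x₁|_∞` (each leg has `≤ |x₀ − x₁|_∞` bonds, p30's `min_val_le_supDist`).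
[cite: Balaban1983RegularityDecay, (1.9) p.573] -/
theorem norm_stairHol_mul_sub_le (U : GaugeField P j U1) {c' : ℝ} (hc : c' ≠ 0) (ψ : Balaban1983to89.Site P j → ℂ)
    (x₀ x₁ : Balaban1983to89.Site P j) {B : ℝ} (hB0 : 0 ≤ B)
    (hBf : ∀ (m : Fin P.d) (s : ℕ), (x₁ m - x₀ m).val ≤ (x₀ m - x₁ m).val → s < (x₁ m - x₀ m).val →
      ‖covD c' (cfg U) ψ ⟨runSite (stairPt x₀ x₁ m.val) m s, m⟩‖ ≤ B)
    (hBb : ∀ (m : Fin P.d) (s : ℕ), ¬ (x₁ m - x₀ m).val ≤ (x₀ m - x₁ m).val → s < (x₀ m - x₁ m).val →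
      ‖covD c' (cfg U) ψ ⟨runSite (stairPt x₀ x₁ (m.val + 1)) m s, m⟩‖ ≤ B) :
    ‖stairHol U x₀ x₁ * ψ x₁ - ψ x₀‖ ≤ |c'|⁻¹ * B * (P.d * supDist x₀ x₁) := by
  have h0 : stairPt x₀ x₁ 0 = x₀ := stairPt_zero x₀ x₁
  have hd : stairPt x₀ x₁ P.d = x₁ := stairPt_of_le x₀ x₁ le_rfl
  have htel := stair_telescope U x₀ x₁ ψ P.d
  rw [h0, hd] at htel
  refine htel.trans ?_
  have hleg : ∀ m ∈ Finset.range P.d, ‖legHol U x₀ x₁ m * ψ (stairPt x₀ x₁ (m + 1)) - ψ (stairPt x₀ x₁ m)‖ ≤ |c'|⁻¹ * B * supDist x₀ x₁ := by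
    intro m hm
    rw [Finset.mem_range] at hm
    have h := norm_legHol_mul_sub_le U hc ψ x₀ x₁ ⟨m, hm⟩
    refine h.trans ?_
    rw [mul_assoc]
    refine mul_le_mul_of_nonneg_left ?_ (inv_nonneg.2 (abs_nonneg _))
    have hmin := min_val_le_supDist x₀ x₁ ⟨m, hm⟩
    split_ifs with hle
    · calc ∑ s ∈ Finset.range (x₁ ⟨m, hm⟩ - x₀ ⟨m, hm⟩).val, ‖covD c' (cfg U) ψ ⟨runSite (stairPt x₀ x₁ m) ⟨m, hm⟩ s, ⟨m, hm⟩⟩‖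
          ≤ ∑ _s ∈ Finset.range (x₁ ⟨m, hm⟩ - x₀ ⟨m, hm⟩).val, B :=
            Finset.sum_le_sum fun s hs => hBf ⟨m, hm⟩ s hle (Finset.mem_range.1 hs)
        _ = (x₁ ⟨m, hm⟩ - x₀ ⟨m, hm⟩).val * B := by rw [Finset.sum_const, Finset.card_range, nsmul_eq_mul]
        _ ≤ supDist x₀ x₁ * B := by
            refine mul_le_mul_of_nonneg_right ?_ hB0
            exact_mod_cast (min_eq_left hle ▸ hmin)
        _ = B * supDist x₀ x₁ := mul_comm _ _
    · calc ∑ s ∈ Finset.range (x₀ ⟨m, hm⟩ - x₁ ⟨m, hm⟩).val, ‖covD c' (cfg U) ψ ⟨runSite (stairPt x₀ x₁ (m + 1)) ⟨m, hm⟩ s, ⟨m, hm⟩⟩‖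
          ≤ ∑ _s ∈ Finset.range (x₀ ⟨m, hm⟩ - x₁ ⟨m, hm⟩).val, B :=
            Finset.sum_le_sum fun s hs => hBb ⟨m, hm⟩ s hle (Finset.mem_range.1 hs)
        _ = (x₀ ⟨m, hm⟩ - x₁ ⟨m, hm⟩).val * B := by rw [Finset.sum_const, Finset.card_range, nsmul_eq_mul]
        _ ≤ supDist x₀ x₁ * B := by
            refine mul_le_mul_of_nonneg_right ?_ hB0
            exact_mod_cast (min_eq_right (not_le.1 hle).le ▸ hmin)
        _ = B * supDist x₀ x₁ := mul_comm _ _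
  calc ∑ l ∈ Finset.range P.d, ‖legHol U x₀ x₁ l * ψ (stairPt x₀ x₁ (l + 1)) - ψ (stairPt x₀ x₁ l)‖
      ≤ ∑ _l ∈ Finset.range P.d, |c'|⁻¹ * B * supDist x₀ x₁ := Finset.sum_le_sum hleg
    _ = |c'|⁻¹ * B * (P.d * supDist x₀ x₁) := by rw [Finset.sum_const, Finset.card_range, nsmul_eq_mul]; ring

/-! ## §2 The staircase stays within `|x₀ − x₁|_∞` of both end points (corners: p30; run points of the legs: here) -/

/-- kernel: the circular distance of the `m`-th coordinates is the shorter residue. [cite: Balaban1984PropagatorsI, (1.7) p.18] -/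
theorem cdist_coord_eq_min (x₀ x₁ : Balaban1983to89.Site P j) (m : Fin P.d) :
    cdist (x₁ m - x₀ m) = min (x₁ m - x₀ m).val (x₀ m - x₁ m).val := by
  rw [cdist, neg_sub]

/-- kernel: a natural residue has value `≤` itself. [folklore] -/
private theorem val_natCast_le {n : ℕ} [NeZero n] (s : ℕ) : ((s : ZMod n)).val ≤ s := by
  rw [ZMod.val_natCast]; exact Nat.mod_le _ _

/-- **The run points of a FORWARD leg stay within `|x₀ − x₁|_∞` of `x₀` and of `x₁`** (`w = stairPt m + se_m`, `s ≤ s_f ≤ s_b`: off the axis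
`m` the coordinates are corner coordinates, on the axis the residues are `s` and `s_f − s`). [cite: Balaban1984PropagatorsI, (1.7) p.18] -/
theorem supDist_run_fwd_le (x₀ x₁ : Balaban1983to89.Site P j) (m : Fin P.d) {s : ℕ} (hs : s ≤ (x₁ m - x₀ m).val)
    (hle : (x₁ m - x₀ m).val ≤ (x₀ m - x₁ m).val) :
    supDist x₀ (runSite (stairPt x₀ x₁ m.val) m s) ≤ supDist x₀ x₁ ∧ supDist x₁ (runSite (stairPt x₀ x₁ m.val) m s) ≤ supDist x₀ x₁ := by
  have hsf : (x₁ m - x₀ m).val ≤ supDist x₀ x₁ := by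
    have h := cdist_le_supDist x₁ x₀ m
    rw [cdist_coord_eq_min, min_eq_left hle, supDist_comm] at h
    exact h
  have hmm : stairPt x₀ x₁ m.val m = x₀ m := by simp [stairPt]
  have hsval : ((s : ZMod (P.sitesPerDir j))).val ≤ s := val_natCast_le s
  constructor
  · rw [supDist_eq_sup_cdist]
    refine Finset.sup_le fun κ _ => ?_
    by_cases hκ : κ = m
    · subst hκ
      rw [runSite_apply_self, hmm, sub_add_cancel_left, cdist_neg]
      exact ((cdist_le_val _).trans hsval).trans (hs.trans hsf)
    · rw [runSite_apply_ne _ hκ]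
      exact (cdist_le_supDist x₀ (stairPt x₀ x₁ m.val) κ).trans (BIJ85ScalarPropagatorHolderDecay.supDist_stairPt_le x₀ x₁ m.val)
  · rw [supDist_eq_sup_cdist]
    refine Finset.sup_le fun κ _ => ?_
    by_cases hκ : κ = m
    · subst hκ
      rw [runSite_apply_self, hmm, ← sub_sub]
      refine (cdist_le_val _).trans ?_
      rw [ZMod.val_sub (hsval.trans hs)]
      exact (Nat.sub_le _ _).trans hsf
    · rw [runSite_apply_ne _ hκ]
      exact (cdist_le_supDist x₁ (stairPt x₀ x₁ m.val) κ).trans (BIJ85ScalarPropagatorHolderDecay.supDist_stairPt_le' x₀ x₁ m.val)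

/-- **The run points of a BACKWARD leg stay within `|x₀ − x₁|_∞` of `x₀` and of `x₁`** (`w = stairPt (m+1) + se_m`, `s ≤ s_b < s_f`).
[cite: Balaban1984PropagatorsI, (1.7) p.18] -/
theorem supDist_run_bwd_le (x₀ x₁ : Balaban1983to89.Site P j) (m : Fin P.d) {s : ℕ} (hs : s ≤ (x₀ m - x₁ m).val)
    (hlt : ¬ (x₁ m - x₀ m).val ≤ (x₀ m - x₁ m).val) :
    supDist x₀ (runSite (stairPt x₀ x₁ (m.val + 1)) m s) ≤ supDist x₀ x₁ ∧
      supDist x₁ (runSite (stairPt x₀ x₁ (m.val + 1)) m s) ≤ supDist x₀ x₁ := by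
  have hsb : (x₀ m - x₁ m).val ≤ supDist x₀ x₁ := by
    have h := cdist_le_supDist x₁ x₀ m
    rw [cdist_coord_eq_min, min_eq_right (not_le.1 hlt).le, supDist_comm] at h
    exact h
  have hmm : stairPt x₀ x₁ (m.val + 1) m = x₁ m := by simp [stairPt]
  have hsval : ((s : ZMod (P.sitesPerDir j))).val ≤ s := val_natCast_le s
  constructor
  · rw [supDist_eq_sup_cdist]
    refine Finset.sup_le fun κ _ => ?_
    by_cases hκ : κ = m
    · subst hκ
      rw [runSite_apply_self, hmm, ← sub_sub]
      refine (cdist_le_val _).trans ?_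
      rw [ZMod.val_sub (hsval.trans hs)]
      exact (Nat.sub_le _ _).trans hsb
    · rw [runSite_apply_ne _ hκ]
      exact (cdist_le_supDist x₀ (stairPt x₀ x₁ (m.val + 1)) κ).trans
        (BIJ85ScalarPropagatorHolderDecay.supDist_stairPt_le x₀ x₁ (m.val + 1))
  · rw [supDist_eq_sup_cdist]
    refine Finset.sup_le fun κ _ => ?_
    by_cases hκ : κ = m
    · subst hκ
      rw [runSite_apply_self, hmm, sub_add_cancel_left, cdist_neg]
      exact ((cdist_le_val _).trans hsval).trans (hs.trans hsb)
    · rw [runSite_apply_ne _ hκ]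
      exact (cdist_le_supDist x₁ (stairPt x₀ x₁ (m.val + 1)) κ).trans
        (BIJ85ScalarPropagatorHolderDecay.supDist_stairPt_le' x₀ x₁ (m.val + 1))

/-- **TELESCOPING FROM A BOND BOUND ON THE `|x₀ − x₁|_∞`-NEIGHBOURHOOD**: if `‖(D^{c′}_uψ)(⟨w, m⟩)‖ ≤ B` for every site `w` within sup-torus
distance `|x₀ − x₁|_∞` of `x₀` AND of `x₁` and every direction `m`, then `‖U(Γ_{x₀,x₁})ψ(x₁) − ψ(x₀)‖ ≤ |c′|⁻¹·B·d·|x₀ − x₁|_∞`.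
[cite: Balaban1983RegularityDecay, (1.9) p.573] -/
theorem norm_stairHol_mul_sub_le_of_near (U : GaugeField P j U1) {c' : ℝ} (hc : c' ≠ 0) (ψ : Balaban1983to89.Site P j → ℂ)
    (x₀ x₁ : Balaban1983to89.Site P j) {B : ℝ} (hB0 : 0 ≤ B)
    (hB : ∀ (w : Balaban1983to89.Site P j) (m : Fin P.d), supDist x₀ w ≤ supDist x₀ x₁ → supDist x₁ w ≤ supDist x₀ x₁ →
      ‖covD c' (cfg U) ψ ⟨w, m⟩‖ ≤ B) :
    ‖stairHol U x₀ x₁ * ψ x₁ - ψ x₀‖ ≤ |c'|⁻¹ * B * (P.d * supDist x₀ x₁) := by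
  refine norm_stairHol_mul_sub_le U hc ψ x₀ x₁ hB0 (fun m s hle hs => ?_) (fun m s hle hs => ?_)
  · obtain ⟨h1, h2⟩ := supDist_run_fwd_le x₀ x₁ m hs.le hle
    exact hB _ m h1 h2
  · obtain ⟨h1, h2⟩ := supDist_run_bwd_le x₀ x₁ m hs.le hle
    exact hB _ m h1 h2

/-! ## §3 The Hölder member of order `1 + θ` of (2.30) at non-flat small fields, for the torus data of record and a SMOOTH cut-off -/

section DerivHolder

open BIJ85BlockAveragesTorus BIJ85BlockAveragesTorusK
open BIJ88NeumannPropagator227Torus (gBox)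
open BIJ88DeltaLoc234Torus (gLocT)
open BIJ88NeumannPropagatorFlatDecayCube
open BIJ88NeumannPropagatorFlatClose231 (norm_rowSource_le rowSource_ne_zero abs_lam_le_one)
open BIJ88LocWeights227Torus
open BIJ88LocDeriv230FlatTorus (T_shift_le_one abs_T_shift_sub_le covD_gLocT_apply)
open BIJ88LocDeriv230ZetaPiFlatTorus (norm_rowSource_sub_le_of_lipschitz)
open BIJ88LocDerivHolder230FlatTorus (abs_weight_shift_sub_le_of_hull abs_weight_bondDiff_sub_le_of_hull)
open BIJ88LocDeriv230SmallFieldTorus (smallField_cubeFam)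
open BIJ88LocDeriv230SmallFieldOpTorus (deriv230_smallField_op_of_lipschitz)
open BIJ88NeumannPropagatorSmallFieldCubeDeriv (decay110_smallField_cube_deriv)
open BIJ88NeumannPropagatorSmallFieldSupDecay (decay110_smallField_cube)
open BIJ88NeumannPropagatorSmallFieldCubeHolderDecay (holder19_smallField_cube_input)
open BIJ85ScalarPropagatorHolderDecay (norm_stairHol)
open B3Bound323ZeroTorus (T_eq_supDist)
open B4Reflection242 (boxDom mem_boxDom)

variable {d : ℕ}

/-- kernel: for `1 ≤ t` and `θ ≤ 1`, `t^θ ≤ t`. [folklore] -/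
private theorem rpow_le_self_of_one_le {t θ : ℝ} (ht : 1 ≤ t) (hθ : θ ≤ 1) : t ^ θ ≤ t := by
  have h := Real.rpow_le_rpow_of_exponent_le ht hθ
  rwa [Real.rpow_one] at h

/-- kernel: `exp (-(t₁ * D / n)) ≤ exp (-(t * (n⁻¹ * D)))` for `t ≤ t₁`, `0 < n`, `0 ≤ D`. [folklore] -/
private theorem exp_div_le {t t₁ n D : ℝ} (ht : t ≤ t₁) (hn : 0 < n) (hD : 0 ≤ D) :
    Real.exp (-(t₁ * D / n)) ≤ Real.exp (-(t * (n⁻¹ * D))) := by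
  refine Real.exp_le_exp.2 (neg_le_neg ?_)
  rw [mul_comm n⁻¹ D, ← div_eq_mul_inv, mul_div_assoc]
  exact mul_le_mul_of_nonneg_right ht (div_nonneg hD hn.le)

/-- kernel: `D_u(Gf) − D_u(Gg) = D_u(G(f − g))`. [cite: BalabanImbrieJaffe1988, (3.2) p.265] -/
private theorem covD_mulVec_sub (c' : ℝ) (u : PBond P 0 → ℂ) (G : Matrix (Balaban1983to89.Site P 0) (Balaban1983to89.Site P 0) ℂ)
    (f g : Balaban1983to89.Site P 0 → ℂ) (b : PBond P 0) :
    covD c' u (G *ᵥ f) b - covD c' u (G *ᵥ g) b = covD c' u (G *ᵥ (f - g)) b := by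
  simp only [covD, Matrix.mulVec_sub, Pi.sub_apply]
  ring

/-- kernel: `D_u` of the zero function vanishes. [cite: BalabanImbrieJaffe1988, (3.2) p.265] -/
private theorem covD_zero (c' : ℝ) (u : PBond P 0 → ℂ) (b : PBond P 0) : covD c' u (0 : Balaban1983to89.Site P 0 → ℂ) b = 0 := by
  simp only [covD, Pi.zero_apply, mul_zero, sub_zero]

/-- kernel: the staircase from a point to itself transports trivially. [cite: Balaban1983RegularityDecay, (1.9) p.573] -/
theorem stairHol_self (U : GaugeField P j U1) (x : Balaban1983to89.Site P j) : stairHol U x x = 1 := by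
  unfold stairHol
  refine Finset.prod_eq_one fun m hm => ?_
  rw [Finset.mem_range] at hm
  unfold legHol
  rw [dif_pos hm, if_pos le_rfl, sub_self, ZMod.val_zero, axisHol_zero, toC_one]

set_option maxHeartbeats 800000 in
/-- **THE HÖLDER MEMBER OF ORDER `1 + θ` (`0 ≤ θ < 1`) OF (2.30) AT NON-FLAT SMALL FIELDS FOR THE TORUS CUBES AND WEIGHTS OF RECORD AND A
SMOOTH CUT-OFF** (p. 263: *"Bounds analogous to (2.30), (2.31) hold for covariant derivatives and Hölder derivatives of G_{k,loc}(u) of order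
less than two"* — the member of top order, [6] (1.9) for `G_{k,loc}(u)`: the Hölder quotient of the covariant derivative, transported by
`U(A(Γ_{x₁,x₂}))` along p30's shortest staircase `Γ`).  For `d + 1 ∈ {2,3}`, `L` odd `> 1`, `a > 0`, `0 ≤ θ < 1` and moduli `K₁, K₂ ≥ 0` THERE
EXIST `t₀, c₀ > 0` depending on `(d, L, a, θ, K₁, K₂)` only such that for every volume (`P.d = d+1`, `P.L = L`), every `1 ≤ k ≤ K_P`, every
no-wrap box `Ω₀ = c·L^k + Π_i[0, L^kM₀_i)` shorter than the torus leaving a torus gap `≥ R`, cube spacing `s ≥ 1`, half-width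
`W ≥ 2s/3 + R₀/2 + R`, radii `4L^k + 1 < R`, `0 ≤ R₁ < R₀`, `3L^k ≤ R₀`, EVERY real cut-off `ζ″` with `|ζ″| ≤ 1`, `= 0` beyond `R₀`, first
lattice differences in `x` bounded by `K₁/(R₀−R₁)` and second ones by `K₂/(R₀−R₁)²`, every `U(1)` field `u` with plaquette variables
`|u(∂p) − 1| ≤ θ_p` on the torus (`2(d+1)³(L^{2k}θ_p)² ≤ 1`) and bondwise small inside `Ω₀` (p27's `(T, δ)`), every direction `μ`, all bonds
`⟨x₁, x₁+e_μ⟩`, `⟨x₂, x₂+e_μ⟩` with their four end points in `Ω₀` at chart depth `≥ R₀`, and every `f` (`‖f‖_∞ ≤ F`) supported at sup-torus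
distance `≥ D ≥ 0` from `x₁` and from `x₂`:
`(L^k/|x₁ − x₂|_T)^θ·‖U(Γ_{x₁,x₂})(D_uG_{k,loc}(u)f)(x₂, μ) − (D_uG_{k,loc}(u)f)(x₁, μ)‖ ≤ (L^kε)·c₀·m·(1 + L^k((R₀ − R₁)⁻¹ + s⁻¹))²·e^{−t₀D/L^k}·F`,
`m = (⌊(L^k − 1 + R₀)/s⌋ + 3)^{d+1}`, `U(Γ_{x₁,x₂})` = p30's `stairHol u x₁ x₂`.  MECHANISM (near pairs `|x₁ − x₂|_T ≤ L^k`): gen 27's bond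
identity `covD_gLocT_apply` at both bonds and gen 28's four-term split — (A) [6] (1.9) for each cube active at `x₂ + e_μ` on its fixed row
source (p27's `holder19_smallField_cube_input`, both points `3L^k`-deep in the cube since `R > 4L^k + 1`, `R₀ ≥ 3L^k`), (B) p34's `k`-uniform
(1.10) derivative member `decay110_smallField_cube_deriv` on the difference of the row sources of `x₂ + e_μ`, `x₁ + e_μ` (Lipschitz along the
chart hull, gen 28's `abs_weight_shift_sub_le_of_hull`), (C) the transported difference of the VALUES of the cube propagators on the
bond-difference source of `x₂`, telescoped bond by bond ALONG THE STAIRCASE at the non-flat `u` (§1 `norm_stairHol_mul_sub_le_of_near`, §2: the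
staircase stays within `|x₁ − x₂|_T` of both points, hence `L^k`-deep in the active cube) with p34's member per bond, (D) p27's `k`-uniform
(1.10) value member `decay110_smallField_cube` on the difference of the bond-difference sources — a SECOND difference of the row weights (gen
28's `abs_weight_bondDiff_sub_le_of_hull`); far pairs: two covariant-derivative members (gen 29's `deriv230_smallField_op_of_lipschitz`),
`|U(Γ)| = 1`. [cite: BalabanImbrieJaffe1988, (2.30) p.263] [cite: Balaban1983RegularityDecay, Theorem p.573 (1.9)] -/
theorem derivHolder230_smallField_of_smooth (d L : ℕ) (hd1 : 1 ≤ d) (hd3 : d + 1 ≤ 3) (hL : Odd L ∧ 1 < L) {a : ℝ} (ha : 0 < a)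
    {θ : ℝ} (hθ0 : 0 ≤ θ) (hθ1 : θ < 1) {K₁ K₂ : ℝ} (hK₁ : 0 ≤ K₁) (hK₂ : 0 ≤ K₂) :
    ∃ t₀ c₀ : ℝ, 0 < t₀ ∧ 0 < c₀ ∧ ∀ (P : Params) (hPd : P.d = d + 1), P.L = L →
      ∀ k : ℕ, 1 ≤ k → k ≤ P.K → ∀ (c M0 : Fin (d + 1) → ℕ), (∀ i, 1 ≤ M0 i) →
        (∀ i, c i * P.L ^ k + P.L ^ k * M0 i ≤ P.sitesPerDir 0) → (∀ i, P.L ^ k * M0 i < P.sitesPerDir 0) →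
      ∀ (s W : ℕ), 1 ≤ s → ∀ (R R₀ R₁ : ℝ), 4 * (P.L : ℝ) ^ k + 1 < R → 0 ≤ R₁ → R₁ < R₀ → 3 * (P.L : ℝ) ^ k ≤ R₀ →
        2 * (s : ℝ) / 3 + R₀ / 2 + R ≤ W → (∀ i, ((P.L ^ k * M0 i : ℕ) : ℝ) + R ≤ P.sitesPerDir 0) →
      ∀ (ζ : Balaban1983to89.Site P 0 → Balaban1983to89.Site P 0 → ℝ), (∀ x y, |ζ x y| ≤ 1) →
        (∀ x y, R₀ ≤ B5Ineq137Torus.T P 0 x y → ζ x y = 0) →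
        (∀ (x y : Balaban1983to89.Site P 0) (ν : Fin P.d), |ζ (x.shift ν) y - ζ x y| ≤ K₁ / (R₀ - R₁)) →
        (∀ (x y : Balaban1983to89.Site P 0) (κ ν : Fin P.d),
          |ζ ((x.shift ν).shift κ) y - ζ (x.shift ν) y - ζ (x.shift κ) y + ζ x y| ≤ K₂ / (R₀ - R₁) ^ 2) →
      ∀ (U : GaugeField P 0 U1) (θp Tu δu : ℝ), 0 ≤ θp →
        (∀ p : Balaban1983to89.Plaq P 0, ‖toC (GaugeField.plaqHol U p) - 1‖ ≤ θp) →
        2 * (P.d : ℝ) ^ 3 * (((P.L : ℝ) ^ k) ^ 2 * θp) ^ 2 ≤ 1 →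
        (∀ b ∈ starB (cubeT hPd (P.L ^ k) c fun i => P.L ^ k * M0 i), blkIter k b.src = blkIter k b.tgt → ‖toC (U b) - 1‖ ≤ Tu) →
        (∀ x ∈ (cubeT hPd (P.L ^ k) c fun i => P.L ^ k * M0 i), ‖holCK U k x - 1‖ ≤ δu) →
        2 * (((P.L : ℝ) ^ k - 1) * (P.L : ℝ) ^ k) * P.d * Tu ^ 2 + 2 * δu ^ 2 ≤ 1 / 2 →
      ∀ (x₁ x₂ : Balaban1983to89.Site P 0) (μ : Fin P.d),
        x₁ ∈ (cubeT hPd (P.L ^ k) c fun i => P.L ^ k * M0 i) →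
        (∀ i, R₀ ≤ (boxCoord hPd (P.L ^ k) c x₁ i : ℝ) ∧ (boxCoord hPd (P.L ^ k) c x₁ i : ℝ) + R₀ ≤ (P.L ^ k * M0 i : ℕ) - 1) →
        x₁.shift μ ∈ (cubeT hPd (P.L ^ k) c fun i => P.L ^ k * M0 i) →
        (∀ i, R₀ ≤ (boxCoord hPd (P.L ^ k) c (x₁.shift μ) i : ℝ) ∧
          (boxCoord hPd (P.L ^ k) c (x₁.shift μ) i : ℝ) + R₀ ≤ (P.L ^ k * M0 i : ℕ) - 1) →
        x₂ ∈ (cubeT hPd (P.L ^ k) c fun i => P.L ^ k * M0 i) →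
        (∀ i, R₀ ≤ (boxCoord hPd (P.L ^ k) c x₂ i : ℝ) ∧ (boxCoord hPd (P.L ^ k) c x₂ i : ℝ) + R₀ ≤ (P.L ^ k * M0 i : ℕ) - 1) →
        x₂.shift μ ∈ (cubeT hPd (P.L ^ k) c fun i => P.L ^ k * M0 i) →
        (∀ i, R₀ ≤ (boxCoord hPd (P.L ^ k) c (x₂.shift μ) i : ℝ) ∧
          (boxCoord hPd (P.L ^ k) c (x₂.shift μ) i : ℝ) + R₀ ≤ (P.L ^ k * M0 i : ℕ) - 1) →
      ∀ (f : Balaban1983to89.Site P 0 → ℂ) (F D : ℝ), (∀ y, ‖f y‖ ≤ F) → 0 ≤ D →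
        (∀ y, f y ≠ 0 → D ≤ B5Ineq137Torus.T P 0 x₁ y) → (∀ y, f y ≠ 0 → D ≤ B5Ineq137Torus.T P 0 x₂ y) →
        ((P.L : ℝ) ^ k / B5Ineq137Torus.T P 0 x₁ x₂) ^ θ *
          ‖stairHol U x₁ x₂ *
              covD P.eps⁻¹ (cfg U)
                (gLocT (B1RG242Torus.α P a k * (P.L : ℝ) ^ (k * P.d)) P.eps⁻¹ U k
                  (cubeFam hPd (P.L ^ k) c M0 s W) (lamFam hPd (P.L ^ k) c M0 s) ζ *ᵥ f) ⟨x₂, μ⟩ -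
            covD P.eps⁻¹ (cfg U)
                (gLocT (B1RG242Torus.α P a k * (P.L : ℝ) ^ (k * P.d)) P.eps⁻¹ U k
                  (cubeFam hPd (P.L ^ k) c M0 s W) (lamFam hPd (P.L ^ k) c M0 s) ζ *ᵥ f) ⟨x₁, μ⟩‖ ≤
          P.spacing k * (c₀ * (⌊(((P.L : ℝ) ^ k) - 1 + R₀) / s⌋₊ + 3) ^ (d + 1) *
            (1 + (P.L : ℝ) ^ k * ((R₀ - R₁)⁻¹ + (s : ℝ)⁻¹)) ^ 2 * Real.exp (-(t₀ * (((P.L : ℝ) ^ k)⁻¹ * D))) * F) := by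
  obtain ⟨δH, cH, hδH, hcH, HH⟩ := holder19_smallField_cube_input d L hd1 hd3 hL ha hθ0 hθ1
  obtain ⟨δ₁, c₁, hδ₁, hc₁, H1⟩ := decay110_smallField_cube_deriv d L hd1 hd3 hL ha
  obtain ⟨δ₂, c₂, hδ₂, hc₂, H2⟩ := decay110_smallField_cube d (L - 1) hd3 (by omega) ha
  obtain ⟨δg, cg, hδg, hcg, Hg⟩ := deriv230_smallField_op_of_lipschitz d L hd1 hd3 hL ha hK₁
  -- the constants
  set Λ₀ : ℝ := max K₁ (3 * Real.pi * (d + 1 : ℕ) / 2) with hΛ₀def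
  have hΛ₀0 : 0 ≤ Λ₀ := hK₁.trans (le_max_left _ _)
  set Λ₀₂ : ℝ := K₂ + 4 * Real.pi ^ 2 + 3 * Real.pi * (d + 1 : ℕ) * K₁ with hΛ₀₂def
  have hΛ₀₂0 : 0 ≤ Λ₀₂ := by rw [hΛ₀₂def]; positivity
  set CB : ℝ := 2 * ((d : ℝ) + 1) * Λ₀ * c₁ with hCBdef
  set CC : ℝ := 2 * ((d : ℝ) + 1) * Real.exp δ₁ * Λ₀ * c₁ with hCCdef
  set CD : ℝ := 4 * ((d : ℝ) + 1) * Λ₀₂ * c₂ with hCDdef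
  have hCB0 : 0 ≤ CB := by rw [hCBdef]; positivity
  have hCC0 : 0 ≤ CC := by rw [hCCdef]; positivity
  have hCD0 : 0 ≤ CD := by rw [hCDdef]; positivity
  set C : ℝ := cH + CB + CC + CD + 2 * cg with hCdef
  have hC0 : 0 < C := by rw [hCdef]; positivity
  refine ⟨min (min δH δ₁) (min δ₂ δg), C, lt_min (lt_min hδH hδ₁) (lt_min hδ₂ hδg), hC0, ?_⟩
  intro P hPd hPL k hk1 hkK c M0 hM0 hfit0 hN0 s W hs R R₀ R₁ hR hR₁ hR10 hLR₀ hW hgap ζ hζabs hζ0 hζ1 hζ2 U θp Tu δu hθp0 hplaq hθps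
    hInt hTree hsmall x₁ x₂ μ hx₁ hdeep₁ hx₁e hdeep₁e hx₂ hdeep₂ hx₂e hdeep₂e f F D hF hD hsupp₁ hsupp₂
  have hPL' : P.L = L - 1 + 1 := by omega
  set δ := min (min δH δ₁) (min δ₂ δg) with hδdef
  have hδH' : δ ≤ δH := (min_le_left _ _).trans (min_le_left _ _)
  have hδ1 : δ ≤ δ₁ := (min_le_left _ _).trans (min_le_right _ _)
  have hδ2 : δ ≤ δ₂ := (min_le_right _ _).trans (min_le_left _ _)
  have hδg' : δ ≤ δg := (min_le_right _ _).trans (min_le_right _ _)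
  -- elementary facts
  have hn : 1 ≤ P.L ^ k := Nat.one_le_pow _ _ P.L_pos
  have hk : 0 + k ≤ P.m + P.K := by omega
  have hkmK : k ≤ P.m + P.K := by omega
  have hLpos : (0 : ℝ) < P.L := P.cast_L_pos
  have hLk : (0 : ℝ) < (P.L : ℝ) ^ k := pow_pos hLpos _
  have hLk1 : (1 : ℝ) ≤ (P.L : ℝ) ^ k := by exact_mod_cast hn
  have hLkinv : 0 < ((P.L : ℝ) ^ k)⁻¹ := inv_pos.mpr hLk
  have hR1 : 1 < R := by linarith only [hR, hLk]
  have hR0 : 0 ≤ R := by linarith only [hR, hLk]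
  have hRL : (P.L : ℝ) ^ k + 1 ≤ R := by linarith only [hR, hLk]
  have hR₀ : 0 ≤ R₀ := hR₁.trans hR10.le
  have hR₀1 : 1 ≤ R₀ := by linarith only [hLk1, hLR₀]
  have hLR₀' : (P.L : ℝ) ^ k ≤ R₀ := by linarith only [hLR₀, hLk]
  have hs0 : 0 < s := hs
  have hsr : (0 : ℝ) < s := by exact_mod_cast hs0
  have hgap' : 0 < R₀ - R₁ := sub_pos.2 hR10
  have hF0 : 0 ≤ F := (norm_nonneg _).trans (hF x₁)
  have hsp0 : 0 < P.spacing k := P.spacing_pos k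
  have heps : 0 < P.eps := P.eps_pos
  have hK₁' : 0 ≤ K₁ / (R₀ - R₁) := div_nonneg hK₁ hgap'.le
  have hPdR : (P.d : ℝ) = (d : ℝ) + 1 := by rw [hPd]; push_cast; ring
  -- the cubes are bondwise small
  have hcube := smallField_cubeFam hPd hkmK hM0 hfit0 hN0 (s := s) (W := W) hInt hTree
  -- abbreviations
  set Ω₀ : Finset (Balaban1983to89.Site P 0) := cubeT hPd (P.L ^ k) c fun i => P.L ^ k * M0 i with hΩ₀def
  set A : ℝ := B1RG242Torus.α P a k * (P.L : ℝ) ^ (k * P.d) with hAdef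
  set x₁' := x₁.shift μ with hx₁'def
  set x₂' := x₂.shift μ with hx₂'def
  set T12 : ℝ := B5Ineq137Torus.T P 0 x₁ x₂ with hT12def
  have hT0 : 0 ≤ T12 := B5Ineq137Torus.T_nonneg P 0 x₁ x₂
  have hT12N : T12 = (supDist x₁ x₂ : ℝ) := T_eq_supDist P x₁ x₂
  set m : ℝ := ((⌊(((P.L : ℝ) ^ k) - 1 + R₀) / s⌋₊ : ℝ) + 3) ^ (d + 1) with hmdef
  have hm0 : 0 ≤ m := by rw [hmdef]; positivity
  set uv : ℝ := (R₀ - R₁)⁻¹ + (s : ℝ)⁻¹ with huvdef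
  have huv0 : 0 ≤ uv := by rw [huvdef]; positivity
  set br : ℝ := 1 + (P.L : ℝ) ^ k * uv with hbrdef
  have hbr1 : 1 ≤ br := by rw [hbrdef]; exact le_add_of_nonneg_right (by positivity)
  have hbr0 : 0 ≤ br := zero_le_one.trans hbr1
  have hbr2 : br ≤ br ^ 2 := by
    calc br = 1 * br := (one_mul _).symm
      _ ≤ br * br := mul_le_mul_of_nonneg_right hbr1 hbr0
      _ = br ^ 2 := (sq br).symm
  have hLuv : (P.L : ℝ) ^ k * uv ≤ br := by rw [hbrdef]; exact le_add_of_nonneg_left zero_le_one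
  set Ex : ℝ := Real.exp (-(δ * (((P.L : ℝ) ^ k)⁻¹ * D))) with hEdef
  have hE0 : 0 < Ex := Real.exp_pos _
  have hεD : 0 ≤ ((P.L : ℝ) ^ k)⁻¹ * D := mul_nonneg hLkinv.le hD
  have hEH : Real.exp (-(δH * (((P.L : ℝ) ^ k)⁻¹ * D))) ≤ Ex := Real.exp_le_exp.2 (neg_le_neg (mul_le_mul_of_nonneg_right hδH' hεD))
  have hE1 : Real.exp (-(δ₁ * D / (P.L : ℝ) ^ k)) ≤ Ex := exp_div_le hδ1 hLk hD
  have hE2 : Real.exp (-(δ₂ * D / (P.L : ℝ) ^ k)) ≤ Ex := exp_div_le hδ2 hLk hD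
  have hEg : Real.exp (-(δg * (((P.L : ℝ) ^ k)⁻¹ * D))) ≤ Ex := Real.exp_le_exp.2 (neg_le_neg (mul_le_mul_of_nonneg_right hδg' hεD))
  -- the support of the sources in p27's/p34's `supDist` form
  have hsuppN : ∀ (x : Balaban1983to89.Site P 0) (g : Balaban1983to89.Site P 0 → ℂ) (E : ℝ),
      (∀ y, g y ≠ 0 → E ≤ B5Ineq137Torus.T P 0 x y) → ∀ z, g z ≠ 0 → E ≤ (supDist x z : ℝ) := by
    intro x g E hg z hz
    rw [← T_eq_supDist P x z]
    exact hg z hz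
  -- the weight
  set w : ℝ := ((P.L : ℝ) ^ k / T12) ^ θ with hwdef
  have hw0 : 0 ≤ w := Real.rpow_nonneg (div_nonneg hLk.le hT0) θ
  -- the target, factorised
  have hRHS : P.spacing k * (C * m * br ^ 2 * Ex * F) =
      P.spacing k * (C * (⌊(((P.L : ℝ) ^ k) - 1 + R₀) / s⌋₊ + 3) ^ (d + 1) *
        (1 + (P.L : ℝ) ^ k * ((R₀ - R₁)⁻¹ + (s : ℝ)⁻¹)) ^ 2 * Real.exp (-(δ * (((P.L : ℝ) ^ k)⁻¹ * D))) * F) := by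
    rw [hmdef, hbrdef, huvdef, hEdef]
  rw [← hRHS]
  have hRHS0 : 0 ≤ P.spacing k * (C * m * br ^ 2 * Ex * F) := by positivity
  -- coincident points: the difference vanishes
  by_cases hne : x₂ = x₁
  · rw [hne, stairHol_self, one_mul, sub_self, norm_zero, mul_zero]
    exact hRHS0
  by_cases hnear : (P.L : ℝ) ^ k < T12
  · -- FAR PAIRS: two derivative members
    have hTpos : 0 < T12 := hLk.trans hnear
    have hw1 : w ≤ 1 := by
      refine Real.rpow_le_one (div_nonneg hLk.le hT0) ?_ hθ0
      rw [div_le_one hTpos]; exact hnear.le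
    have hg₁ := Hg P hPd hPL k hk1 hkK c M0 hM0 hfit0 hN0 s W hs R R₀ R₁ hRL hR₁ hR10 hLR₀' hW hgap ζ hζabs hζ0 hζ1 U θp Tu δu hθp0 hplaq
      hθps hInt hTree hsmall x₁ μ hx₁ hdeep₁ hx₁e hdeep₁e f F D hF hD hsupp₁
    have hg₂ := Hg P hPd hPL k hk1 hkK c M0 hM0 hfit0 hN0 s W hs R R₀ R₁ hRL hR₁ hR10 hLR₀' hW hgap ζ hζabs hζ0 hζ1 U θp Tu δu hθp0 hplaq
      hθps hInt hTree hsmall x₂ μ hx₂ hdeep₂ hx₂e hdeep₂e f F D hF hD hsupp₂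
    set X₁ := covD P.eps⁻¹ (cfg U) (gLocT A P.eps⁻¹ U k (cubeFam hPd (P.L ^ k) c M0 s W) (lamFam hPd (P.L ^ k) c M0 s) ζ *ᵥ f) ⟨x₁, μ⟩
      with hX₁def
    set X₂ := covD P.eps⁻¹ (cfg U) (gLocT A P.eps⁻¹ U k (cubeFam hPd (P.L ^ k) c M0 s W) (lamFam hPd (P.L ^ k) c M0 s) ζ *ᵥ f) ⟨x₂, μ⟩
      with hX₂def
    have hBg : ∀ X : ℝ, X ≤ P.spacing k * (cg * (⌊(((P.L : ℝ) ^ k) - 1 + R₀) / s⌋₊ + 3) ^ (d + 1) *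
        (1 + (P.L : ℝ) ^ k * ((R₀ - R₁)⁻¹ + (s : ℝ)⁻¹)) * Real.exp (-(δg * (((P.L : ℝ) ^ k)⁻¹ * D))) * F) →
        X ≤ P.spacing k * (cg * m * br * Ex * F) := fun X hX => by
      rw [← hmdef, ← huvdef, ← hbrdef] at hX
      exact hX.trans (mul_le_mul_of_nonneg_left (mul_le_mul_of_nonneg_right (mul_le_mul_of_nonneg_left hEg (by positivity)) hF0) hsp0.le)
    have h1 : ‖X₁‖ ≤ P.spacing k * (cg * m * br * Ex * F) := hBg _ hg₁
    have h2 : ‖X₂‖ ≤ P.spacing k * (cg * m * br * Ex * F) := hBg _ hg₂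
    have hτ : ‖stairHol U x₁ x₂ * X₂‖ = ‖X₂‖ := by rw [norm_mul, norm_stairHol, one_mul]
    calc w * ‖stairHol U x₁ x₂ * X₂ - X₁‖ ≤ 1 * ‖stairHol U x₁ x₂ * X₂ - X₁‖ := mul_le_mul_of_nonneg_right hw1 (norm_nonneg _)
      _ ≤ ‖stairHol U x₁ x₂ * X₂‖ + ‖X₁‖ := by rw [one_mul]; exact norm_sub_le _ _
      _ ≤ P.spacing k * (cg * m * br * Ex * F) + P.spacing k * (cg * m * br * Ex * F) := by rw [hτ]; exact add_le_add h2 h1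
      _ = P.spacing k * ((2 * cg) * m * br * Ex * F) := by ring
      _ ≤ P.spacing k * (C * m * br ^ 2 * Ex * F) := by
          refine mul_le_mul_of_nonneg_left ?_ hsp0.le
          have hc : 2 * cg ≤ C := by rw [hCdef]; linarith only [hcH.le, hCB0, hCC0, hCD0]
          have h3 : (2 * cg) * m * br ≤ C * m * br ^ 2 := mul_le_mul (mul_le_mul_of_nonneg_right hc hm0) hbr2 hbr0 (by positivity)
          exact mul_le_mul_of_nonneg_right (mul_le_mul_of_nonneg_right h3 hE0.le) hF0
  /- NEAR PAIRS -/
  push Not at hnear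
  -- chart coordinates
  obtain ⟨hz₁, hxz₁⟩ := cubePt_boxCoord hPd hfit0 hx₁
  obtain ⟨hz₂, hxz₂⟩ := cubePt_boxCoord hPd hfit0 hx₂
  set z₁ := boxCoord hPd (P.L ^ k) c x₁ with hz₁def
  set z₂ := boxCoord hPd (P.L ^ k) c x₂ with hz₂def
  have hdeepT : ∀ i, T12 ≤ (z₁ i : ℝ) ∧ (z₁ i : ℝ) + T12 ≤ (P.L ^ k * M0 i : ℕ) - 1 := fun i => by
    have h1 := hdeep₁ i
    constructor <;> linarith only [h1.1, h1.2, hnear, hLR₀']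
  have hclose : ∀ i, ((|z₁ i - z₂ i| : ℤ) : ℝ) ≤ T12 := (mem_and_abs_sub_le_of_T_le hPd hfit0 hdeepT le_rfl).2
  have hroom₁ : ∀ j, z₁ j + 1 < ((P.L ^ k * M0 j : ℕ) : ℤ) := fun j => by
    have h1 : ((z₁ j : ℤ) : ℝ) + 2 ≤ ((P.L ^ k * M0 j : ℕ) : ℝ) := by linarith only [(hdeep₁ j).2, hR₀1]
    have h2 : z₁ j + 2 ≤ ((P.L ^ k * M0 j : ℕ) : ℤ) := by exact_mod_cast h1
    omega
  have hroom₂ : ∀ j, z₂ j + 1 < ((P.L ^ k * M0 j : ℕ) : ℤ) := fun j => by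
    have h1 : ((z₂ j : ℤ) : ℝ) + 2 ≤ ((P.L ^ k * M0 j : ℕ) : ℝ) := by linarith only [(hdeep₂ j).2, hR₀1]
    have h2 : z₂ j + 2 ≤ ((P.L ^ k * M0 j : ℕ) : ℤ) := by exact_mod_cast h1
    omega
  have hl1 : ∑ j, ((|z₂ j - z₁ j| : ℤ) : ℝ) ≤ ((d : ℝ) + 1) * T12 := by
    calc ∑ j, ((|z₂ j - z₁ j| : ℤ) : ℝ) ≤ ∑ _j : Fin (d + 1), T12 :=
          Finset.sum_le_sum fun j _ => by rw [abs_sub_comm]; exact hclose j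
      _ = ((d : ℝ) + 1) * T12 := by rw [Finset.sum_const, Finset.card_univ, Fintype.card_fin, nsmul_eq_mul]; push_cast; ring
  -- the shortened support distance near `x₁`
  set D' : ℝ := max (D - T12) 0 with hD'def
  have hD'0 : 0 ≤ D' := le_max_right _ _
  have hexpD' : Real.exp (-(δ₁ * D' / (P.L : ℝ) ^ k)) ≤ Real.exp δ₁ * Ex := by
    have h1 : D - T12 ≤ D' := le_max_left _ _
    have h2 : ((P.L : ℝ) ^ k)⁻¹ * T12 ≤ 1 := by rw [inv_mul_le_iff₀ hLk, mul_one]; exact hnear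
    have e0 : δ₁ * D' / (P.L : ℝ) ^ k = δ₁ * (((P.L : ℝ) ^ k)⁻¹ * D') := by ring
    have h3 : -(δ₁ * (((P.L : ℝ) ^ k)⁻¹ * D')) ≤ δ₁ + -(δ * (((P.L : ℝ) ^ k)⁻¹ * D)) := by
      have h4 : δ₁ * (((P.L : ℝ) ^ k)⁻¹ * (D - T12)) ≤ δ₁ * (((P.L : ℝ) ^ k)⁻¹ * D') :=
        mul_le_mul_of_nonneg_left (mul_le_mul_of_nonneg_left h1 hLkinv.le) hδ₁.le
      have h5 : δ * (((P.L : ℝ) ^ k)⁻¹ * D) ≤ δ₁ * (((P.L : ℝ) ^ k)⁻¹ * D) := mul_le_mul_of_nonneg_right hδ1 hεD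
      have h6 : δ₁ * (((P.L : ℝ) ^ k)⁻¹ * T12) ≤ δ₁ * 1 := mul_le_mul_of_nonneg_left h2 hδ₁.le
      have h7 : δ₁ * (((P.L : ℝ) ^ k)⁻¹ * (D - T12)) = δ₁ * (((P.L : ℝ) ^ k)⁻¹ * D) - δ₁ * (((P.L : ℝ) ^ k)⁻¹ * T12) := by ring
      linarith only [h4, h5, h6, h7]
    calc Real.exp (-(δ₁ * D' / (P.L : ℝ) ^ k)) = Real.exp (-(δ₁ * (((P.L : ℝ) ^ k)⁻¹ * D'))) := by rw [e0]
      _ ≤ Real.exp (δ₁ + -(δ * (((P.L : ℝ) ^ k)⁻¹ * D))) := Real.exp_le_exp.2 h3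
      _ = Real.exp δ₁ * Ex := by rw [Real.exp_add]
  -- the weight against one factor `T12`: `w·T12 ≤ L^k`
  have hwT : w * T12 ≤ (P.L : ℝ) ^ k := by
    rcases hT0.eq_or_lt with hT00 | hTpos
    · rw [← hT00, mul_zero]; exact hLk.le
    · have hq : 1 ≤ (P.L : ℝ) ^ k / T12 := by rw [le_div_iff₀ hTpos, one_mul]; exact hnear
      calc w * T12 ≤ (P.L : ℝ) ^ k / T12 * T12 := mul_le_mul_of_nonneg_right (rpow_le_self_of_one_le hq hθ1.le) hT0
        _ = (P.L : ℝ) ^ k := div_mul_cancel₀ _ hTpos.ne'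
  -- distances between the four end points
  have hT2'2 : B5Ineq137Torus.T P 0 x₂' x₂ ≤ 1 := by rw [B5Ineq137Torus.T_symm]; exact T_shift_le_one x₂ μ
  have hT1'1 : B5Ineq137Torus.T P 0 x₁' x₁ ≤ 1 := by rw [B5Ineq137Torus.T_symm]; exact T_shift_le_one x₁ μ
  have hT21 : B5Ineq137Torus.T P 0 x₂ x₁ = T12 := by rw [B5Ineq137Torus.T_symm]
  have hT2'1 : B5Ineq137Torus.T P 0 x₂' x₁ ≤ 1 + T12 := by
    have := B5Ineq137Torus.T_triangle P 0 x₂' x₂ x₁; linarith only [this, hT2'2, hT21]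
  have hT2'1' : B5Ineq137Torus.T P 0 x₂' x₁' ≤ 2 + T12 := by
    have h1 := B5Ineq137Torus.T_triangle P 0 x₂' x₁ x₁'; have h2 := T_shift_le_one (P := P) x₁ μ; linarith only [h1, h2, hT2'1]
  -- the active-label sets of the four end points
  have hmem : ∀ x : Balaban1983to89.Site P 0, x ∈ blockK k (blkIter k x) := fun x => mem_blockK.2 rfl
  set S : Balaban1983to89.Site P 0 → Finset ↥(labels (P.L ^ k) M0 s) := fun p =>
    (activeLabels hPd (P.L ^ k) c s R₀ (blkIter k p)).subtype fun α => α ∈ labels (P.L ^ k) M0 s with hSdef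
  have hcard : ∀ p, ((S p).card : ℝ) ≤ m := fun p => by
    have h1 := card_subtype_activeLabels_le (hPd := hPd) (c := c) (M0 := M0) hn hs0 hR₀ (blkIter k p)
    have e : (((P.L ^ k : ℕ) : ℕ) : ℝ) = (P.L : ℝ) ^ k := by push_cast; rfl
    rw [e] at h1; exact h1
  have hS : ∀ (p : Balaban1983to89.Site P 0),
      (∀ i, R₀ ≤ (boxCoord hPd (P.L ^ k) c p i : ℝ) ∧ (boxCoord hPd (P.L ^ k) c p i : ℝ) + R₀ ≤ (P.L ^ k * M0 i : ℕ) - 1) →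
      ∀ (α : ↥(labels (P.L ^ k) M0 s)) (y : Balaban1983to89.Site P 0), ζ p y * lamFam hPd (P.L ^ k) c M0 s α p y ≠ 0 → α ∈ S p := by
    intro p hdeep α y hne'
    rw [hSdef, Finset.mem_subtype]
    exact mem_activeLabels_of_ne_zero_of_deep hk hs0 hfit0 hζ0 (hmem p) hdeep hne'
  -- an active cube at a deep point contains every point of `Ω₀` within torus distance `< R` of it
  have memα : ∀ (α : ↥(labels (P.L ^ k) M0 s)) (p : Balaban1983to89.Site P 0), p ∈ Ω₀ →
      (∀ i, R₀ ≤ (boxCoord hPd (P.L ^ k) c p i : ℝ) ∧ (boxCoord hPd (P.L ^ k) c p i : ℝ) + R₀ ≤ (P.L ^ k * M0 i : ℕ) - 1) →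
      (∃ y, ζ p y * lamFam hPd (P.L ^ k) c M0 s α p y ≠ 0) →
      ∀ q ∈ Ω₀, B5Ineq137Torus.T P 0 p q < R → q ∈ cubeFam hPd (P.L ^ k) c M0 s W α := by
    intro α p hp hdeep hex q hq hlt
    obtain ⟨y₀, hy₀⟩ := hex
    obtain ⟨-, -, hfar⟩ := rowHyp_ii hPd hn hs0 hfit0 hR0 hgap hW hζ0 hp hdeep α y₀ hy₀
    by_contra hnot
    exact absurd (hfar q hq hnot).1 (not_le.2 hlt)
  -- … and every point at chart depth `≥ L^k` within `T12 + 2` of it is `L^k`-deep in the cube (p34's row condition)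
  have depthα : ∀ (α : ↥(labels (P.L ^ k) M0 s)) (p : Balaban1983to89.Site P 0), p ∈ Ω₀ →
      (∀ i, R₀ ≤ (boxCoord hPd (P.L ^ k) c p i : ℝ) ∧ (boxCoord hPd (P.L ^ k) c p i : ℝ) + R₀ ≤ (P.L ^ k * M0 i : ℕ) - 1) →
      (∃ y, ζ p y * lamFam hPd (P.L ^ k) c M0 s α p y ≠ 0) →
      ∀ q : Balaban1983to89.Site P 0,
        (∀ i, (P.L : ℝ) ^ k ≤ (boxCoord hPd (P.L ^ k) c q i : ℝ) ∧ (boxCoord hPd (P.L ^ k) c q i : ℝ) + (P.L : ℝ) ^ k ≤ (P.L ^ k * M0 i : ℕ) - 1) →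
        B5Ineq137Torus.T P 0 p q ≤ T12 + 2 → ∀ v, v ∉ cubeFam hPd (P.L ^ k) c M0 s W α → P.L ^ k ≤ supDist q v := by
    intro α p hp hdeep hex q hdeepq hpq v hv
    obtain ⟨y₀, hy₀⟩ := hex
    obtain ⟨-, -, hfar⟩ := rowHyp_ii hPd hn hs0 hfit0 hR0 hgap hW hζ0 hp hdeep α y₀ hy₀
    have hTqv : (P.L : ℝ) ^ k ≤ B5Ineq137Torus.T P 0 q v := by
      by_cases hvΩ : v ∈ Ω₀
      · have h1 := (hfar v hvΩ hv).1
        have h2 := B5Ineq137Torus.T_triangle P 0 p q v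
        linarith only [h1, h2, hpq, hnear, hR, hLk1]
      · by_contra hlt
        push Not at hlt
        exact hvΩ (mem_and_abs_sub_le_of_T_le hPd hfit0 hdeepq hlt.le).1
    rw [T_eq_supDist P q v] at hTqv
    exact_mod_cast hTqv
  -- the `3L^k`-balls around `x₁`, `x₂` lie in every cube active at `x₂'`
  have ballα : ∀ (α : ↥(labels (P.L ^ k) M0 s)), (∃ y, ζ x₂' y * lamFam hPd (P.L ^ k) c M0 s α x₂' y ≠ 0) →
      (∀ y, B5Ineq137Torus.T P 0 x₁ y < 3 * (P.L : ℝ) ^ k → y ∈ cubeFam hPd (P.L ^ k) c M0 s W α) ∧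
      (∀ y, B5Ineq137Torus.T P 0 x₂ y < 3 * (P.L : ℝ) ^ k → y ∈ cubeFam hPd (P.L ^ k) c M0 s W α) := by
    intro α hex
    constructor
    · intro y hy
      have hyΩ : y ∈ Ω₀ := (mem_and_abs_sub_le_of_T_le hPd hfit0 hdeep₁ (hy.le.trans hLR₀)).1
      refine memα α x₂' hx₂e hdeep₂e hex y hyΩ ?_
      have h1 := B5Ineq137Torus.T_triangle P 0 x₂' x₁ y
      linarith only [h1, hT2'1, hy, hnear, hR]
    · intro y hy
      have hyΩ : y ∈ Ω₀ := (mem_and_abs_sub_le_of_T_le hPd hfit0 hdeep₂ (hy.le.trans hLR₀)).1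
      refine memα α x₂' hx₂e hdeep₂e hex y hyΩ ?_
      have h1 := B5Ineq137Torus.T_triangle P 0 x₂' x₂ y
      linarith only [h1, hT2'2, hy, hnear, hR, hLk]
  -- the row sources and their vanishing
  set gs : Balaban1983to89.Site P 0 → ↥(labels (P.L ^ k) M0 s) → Balaban1983to89.Site P 0 → ℂ :=
    fun p α y => (ζ p y : ℂ) * (lamFam hPd (P.L ^ k) c M0 s α p y : ℂ) * f y with hgsdef
  set ds : Balaban1983to89.Site P 0 → Balaban1983to89.Site P 0 → ↥(labels (P.L ^ k) M0 s) → Balaban1983to89.Site P 0 → ℂ :=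
    fun p p' α y => ((ζ p' y : ℂ) * (lamFam hPd (P.L ^ k) c M0 s α p' y : ℂ) - (ζ p y : ℂ) * (lamFam hPd (P.L ^ k) c M0 s α p y : ℂ)) * f y
    with hdsdef
  have hgs0 : ∀ (p : Balaban1983to89.Site P 0) (α : ↥(labels (P.L ^ k) M0 s)),
      (¬∃ y, ζ p y * lamFam hPd (P.L ^ k) c M0 s α p y ≠ 0) → gs p α = 0 := by
    intro p α hex
    push Not at hex
    funext y; rw [hgsdef]; dsimp only; rw [← Complex.ofReal_mul, hex y, Complex.ofReal_zero, zero_mul]; rfl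
  have hds0 : ∀ (p p' : Balaban1983to89.Site P 0) (α : ↥(labels (P.L ^ k) M0 s)),
      (¬∃ y, ζ p' y * lamFam hPd (P.L ^ k) c M0 s α p' y ≠ 0) → (¬∃ y, ζ p y * lamFam hPd (P.L ^ k) c M0 s α p y ≠ 0) → ds p p' α = 0 := by
    intro p p' α hex' hex
    push Not at hex hex'
    funext y; rw [hdsdef]; dsimp only; rw [← Complex.ofReal_mul, ← Complex.ofReal_mul, hex y, hex' y]; simp
  have hgs_le : ∀ p α y, ‖gs p α y‖ ≤ F := fun p α y =>
    norm_rowSource_le (hζabs p y) (abs_lam_le_one (sum_abs_lamT_le_one hfit0) α p y) hF y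
  have hgs_supp : ∀ p α y, gs p α y ≠ 0 → f y ≠ 0 := fun p α y hy => (rowSource_ne_zero hy).2
  have hds_supp : ∀ p p' α y, ds p p' α y ≠ 0 → f y ≠ 0 := fun p p' α y hy => right_ne_zero_of_mul hy
  -- the bond identity at both bonds
  have hid₁ : covD P.eps⁻¹ (cfg U) (gLocT A P.eps⁻¹ U k (cubeFam hPd (P.L ^ k) c M0 s W) (lamFam hPd (P.L ^ k) c M0 s) ζ *ᵥ f) ⟨x₁, μ⟩ =
      ∑ α, covD P.eps⁻¹ (cfg U) (gBox A P.eps⁻¹ U k (cubeFam hPd (P.L ^ k) c M0 s W α) *ᵥ gs x₁' α) ⟨x₁, μ⟩ +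
      ∑ α, ((P.eps⁻¹ : ℝ) : ℂ) * (gBox A P.eps⁻¹ U k (cubeFam hPd (P.L ^ k) c M0 s W α) *ᵥ ds x₁ x₁' α) x₁ :=
    covD_gLocT_apply P.eps⁻¹ (cfg U) A P.eps⁻¹ U k (cubeFam hPd (P.L ^ k) c M0 s W) (lamFam hPd (P.L ^ k) c M0 s) ζ f ⟨x₁, μ⟩
  have hid₂ : covD P.eps⁻¹ (cfg U) (gLocT A P.eps⁻¹ U k (cubeFam hPd (P.L ^ k) c M0 s W) (lamFam hPd (P.L ^ k) c M0 s) ζ *ᵥ f) ⟨x₂, μ⟩ =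
      ∑ α, covD P.eps⁻¹ (cfg U) (gBox A P.eps⁻¹ U k (cubeFam hPd (P.L ^ k) c M0 s W α) *ᵥ gs x₂' α) ⟨x₂, μ⟩ +
      ∑ α, ((P.eps⁻¹ : ℝ) : ℂ) * (gBox A P.eps⁻¹ U k (cubeFam hPd (P.L ^ k) c M0 s W α) *ᵥ ds x₂ x₂' α) x₂ :=
    covD_gLocT_apply P.eps⁻¹ (cfg U) A P.eps⁻¹ U k (cubeFam hPd (P.L ^ k) c M0 s W) (lamFam hPd (P.L ^ k) c M0 s) ζ f ⟨x₂, μ⟩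
  rw [hid₁, hid₂]
  -- the four families of summands
  set τ : ℂ := stairHol U x₁ x₂ with hτdef
  have hτ1 : ‖τ‖ = 1 := norm_stairHol U x₁ x₂
  set Ec : ℂ := ((P.eps⁻¹ : ℝ) : ℂ) with hEcdef
  have hEc : ‖Ec‖ = P.eps⁻¹ := by rw [hEcdef, Complex.norm_real, Real.norm_eq_abs, abs_of_pos (inv_pos.mpr heps)]
  set G : ↥(labels (P.L ^ k) M0 s) → Matrix (Balaban1983to89.Site P 0) (Balaban1983to89.Site P 0) ℂ :=
    fun α => gBox A P.eps⁻¹ U k (cubeFam hPd (P.L ^ k) c M0 s W α) with hGdef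
  set sA : ↥(labels (P.L ^ k) M0 s) → ℂ :=
    fun α => τ * covD P.eps⁻¹ (cfg U) (G α *ᵥ gs x₂' α) ⟨x₂, μ⟩ - covD P.eps⁻¹ (cfg U) (G α *ᵥ gs x₂' α) ⟨x₁, μ⟩ with hsAdef
  set sB : ↥(labels (P.L ^ k) M0 s) → ℂ :=
    fun α => covD P.eps⁻¹ (cfg U) (G α *ᵥ gs x₂' α) ⟨x₁, μ⟩ - covD P.eps⁻¹ (cfg U) (G α *ᵥ gs x₁' α) ⟨x₁, μ⟩ with hsBdef
  set sC : ↥(labels (P.L ^ k) M0 s) → ℂ :=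
    fun α => τ * (Ec * (G α *ᵥ ds x₂ x₂' α) x₂) - Ec * (G α *ᵥ ds x₂ x₂' α) x₁ with hsCdef
  set sD : ↥(labels (P.L ^ k) M0 s) → ℂ :=
    fun α => Ec * (G α *ᵥ ds x₂ x₂' α) x₁ - Ec * (G α *ᵥ ds x₁ x₁' α) x₁ with hsDdef
  have hdecomp : τ * (∑ α, covD P.eps⁻¹ (cfg U) (G α *ᵥ gs x₂' α) ⟨x₂, μ⟩ + ∑ α, Ec * (G α *ᵥ ds x₂ x₂' α) x₂) -
      (∑ α, covD P.eps⁻¹ (cfg U) (G α *ᵥ gs x₁' α) ⟨x₁, μ⟩ + ∑ α, Ec * (G α *ᵥ ds x₁ x₁' α) x₁) =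
      (∑ α, sA α + ∑ α, sB α) + (∑ α, sC α + ∑ α, sD α) := by
    simp only [hsAdef, hsBdef, hsCdef, hsDdef, hGdef, Finset.sum_sub_distrib, mul_add, Finset.mul_sum]
    ring
  /- TERM A: [6] (1.9) for each cube active at `x₂'`, fixed source (p27's cube input, transport `stairHol`) -/
  set BA : ℝ := P.spacing k * (cH * Real.exp (-(δH * (((P.L : ℝ) ^ k)⁻¹ * D))) * F) with hBAdef
  have hBA0 : 0 ≤ BA := by rw [hBAdef]; positivity
  have hsA0 : ∀ α, gs x₂' α = 0 → sA α = 0 := fun α h0 => by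
    simp only [hsAdef]; rw [h0, mulVec_zero, covD_zero, covD_zero, mul_zero, sub_zero]
  have htermA : ∀ α, w * ‖sA α‖ ≤ BA := by
    intro α
    by_cases hex : ∃ y, ζ x₂' y * lamFam hPd (P.L ^ k) c M0 s α x₂' y ≠ 0
    · obtain ⟨hb₁, hb₂⟩ := ballα α hex
      obtain ⟨hBU, hIntα, hTreeα⟩ := hcube α
      obtain ⟨c', M', hM', hfit', hN', hcα⟩ := cubeFam_fits (hPd := hPd) (s := s) (W := W) hM0 hfit0 hN0 α
      rw [hcα] at hb₁ hb₂ hIntα hTreeα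
      have key := HH P hPd hPL k hk1 hkK c' M' hM' hfit' hN' U θp Tu δu hθp0 hplaq hθps hIntα hTreeα hsmall μ x₁ x₂ hne hb₁ hb₂
        (gs x₂' α) F D (hgs_le x₂' α) (fun y hy => hsupp₁ y (hgs_supp x₂' α y hy)) (fun y hy => hsupp₂ y (hgs_supp x₂' α y hy))
      rw [← hcα] at key
      exact key
    · rw [hsA0 α (hgs0 x₂' α hex), norm_zero, mul_zero]; exact hBA0
  have hzeroA : ∀ α, α ∉ S x₂' → sA α = 0 := fun α hα =>
    hsA0 α (hgs0 x₂' α fun ⟨y, hy⟩ => hα (hS x₂' hdeep₂e α y hy))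
  have hsumA : w * ‖∑ α, sA α‖ ≤ m * BA := by
    rw [← Finset.sum_subset (Finset.subset_univ (S x₂')) (fun α _ hα => hzeroA α hα)]
    calc w * ‖∑ α ∈ S x₂', sA α‖ ≤ w * ∑ α ∈ S x₂', ‖sA α‖ := mul_le_mul_of_nonneg_left (norm_sum_le _ _) hw0
      _ = ∑ α ∈ S x₂', w * ‖sA α‖ := Finset.mul_sum _ _ _
      _ ≤ ∑ α ∈ S x₂', BA := Finset.sum_le_sum fun α _ => htermA α
      _ = (S x₂').card * BA := by rw [Finset.sum_const, nsmul_eq_mul]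
      _ ≤ m * BA := mul_le_mul_of_nonneg_right (hcard x₂') hBA0
  /- TERM B: p34's (1.10) derivative member on the difference of the row sources of `x₂'` and `x₁'` -/
  set Λ₁ : ℝ := K₁ / (R₀ - R₁) + 3 * Real.pi * (d + 1 : ℕ) / (2 * s) with hΛ₁def
  have hΛ₁0 : 0 ≤ Λ₁ := by rw [hΛ₁def]; positivity
  set dB : ↥(labels (P.L ^ k) M0 s) → Balaban1983to89.Site P 0 → ℂ := fun α y =>
    ((ζ x₂' y * lamFam hPd (P.L ^ k) c M0 s α x₂' y - ζ x₁' y * lamFam hPd (P.L ^ k) c M0 s α x₁' y : ℝ) : ℂ) * f y with hdBdef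
  have hdB : ∀ α, gs x₂' α - gs x₁' α = dB α := fun α => by
    funext y; simp only [hgsdef, hdBdef, Pi.sub_apply]; push_cast; ring
  have hsB_eq : ∀ α, sB α = covD P.eps⁻¹ (cfg U) (G α *ᵥ dB α) ⟨x₁, μ⟩ := fun α => by
    simp only [hsBdef]; rw [covD_mulVec_sub, hdB]
  have hdB_le : ∀ α y, ‖dB α y‖ ≤ Λ₁ * (((d : ℝ) + 1) * T12) * F := by
    intro α y
    have h1 := abs_weight_shift_sub_le_of_hull (hPd := hPd) (c := c) hs0 hfit0 hN0 hK₁' hζabs hζ1 α.1 hz₁ hz₂ hroom₁ hroom₂ μ y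
    rw [hxz₁, hxz₂] at h1
    simp only [hdBdef]
    rw [norm_mul, Complex.norm_real, Real.norm_eq_abs]
    refine mul_le_mul (h1.trans ?_) (hF y) (norm_nonneg _) (by positivity)
    exact mul_le_mul_of_nonneg_left hl1 hΛ₁0
  have hdB_supp : ∀ α y, dB α y ≠ 0 → f y ≠ 0 := fun α y hy => right_ne_zero_of_mul hy
  -- the chart depth `≥ L^k` of `x₁`
  have hdeepL : ∀ (q : Balaban1983to89.Site P 0),
      (∀ i, R₀ ≤ (boxCoord hPd (P.L ^ k) c q i : ℝ) ∧ (boxCoord hPd (P.L ^ k) c q i : ℝ) + R₀ ≤ (P.L ^ k * M0 i : ℕ) - 1) →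
      ∀ i, (P.L : ℝ) ^ k ≤ (boxCoord hPd (P.L ^ k) c q i : ℝ) ∧ (boxCoord hPd (P.L ^ k) c q i : ℝ) + (P.L : ℝ) ^ k ≤ (P.L ^ k * M0 i : ℕ) - 1 :=
    fun q hq i => ⟨hLR₀'.trans (hq i).1, by linarith only [(hq i).2, hLR₀']⟩
  set BB : ℝ := c₁ * P.spacing k * Real.exp (-(δ₁ * D / (P.L : ℝ) ^ k)) * (Λ₁ * (((d : ℝ) + 1) * T12) * F) with hBBdef
  have hBB0 : 0 ≤ BB := by rw [hBBdef]; positivity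
  have htermB : ∀ α, ‖sB α‖ ≤ BB := by
    intro α
    by_cases hex : (∃ y, ζ x₂' y * lamFam hPd (P.L ^ k) c M0 s α x₂' y ≠ 0) ∨ (∃ y, ζ x₁' y * lamFam hPd (P.L ^ k) c M0 s α x₁' y ≠ 0)
    · obtain ⟨hBU, hIntα, hTreeα⟩ := hcube α
      obtain ⟨c', M', hM', hfit', hN', hcα⟩ := cubeFam_fits (hPd := hPd) (s := s) (W := W) hM0 hfit0 hN0 α
      have hdepth : ∀ v, v ∉ cubeFam hPd (P.L ^ k) c M0 s W α → P.L ^ k ≤ supDist x₁ v := by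
        rcases hex with hex | hex
        · exact depthα α x₂' hx₂e hdeep₂e hex x₁ (hdeepL x₁ hdeep₁) (by linarith only [hT2'1])
        · exact depthα α x₁' hx₁e hdeep₁e hex x₁ (hdeepL x₁ hdeep₁) (by linarith only [hT1'1, hT0])
      rw [hcα] at hIntα hTreeα hdepth
      have key := H1 P hPd hPL k hk1 hkK c' M' hM' hfit' hN' U θp Tu δu hθp0 hplaq hθps hIntα hTreeα hsmall x₁ μ (dB α)
        (Λ₁ * (((d : ℝ) + 1) * T12) * F) D (hdB_le α) (hsuppN x₁ (dB α) D fun y hy => hsupp₁ y (hdB_supp α y hy)) hdepth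
      rw [← hcα] at key
      rw [hsB_eq α]; exact key
    · push Not at hex
      simp only [hsBdef]
      rw [hgs0 x₂' α (not_exists.2 fun y hy => hy (hex.1 y)), hgs0 x₁' α (not_exists.2 fun y hy => hy (hex.2 y))]
      simp only [mulVec_zero, covD_zero, sub_self, norm_zero]
      exact hBB0
  have hzeroB : ∀ α, α ∉ S x₂' ∪ S x₁' → sB α = 0 := by
    intro α hα
    rw [Finset.mem_union, not_or] at hα
    simp only [hsBdef]
    rw [hgs0 x₂' α fun ⟨y, hy⟩ => hα.1 (hS x₂' hdeep₂e α y hy), hgs0 x₁' α fun ⟨y, hy⟩ => hα.2 (hS x₁' hdeep₁e α y hy)]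
    simp only [mulVec_zero, covD_zero, sub_self]
  have hsumB : ‖∑ α, sB α‖ ≤ 2 * m * BB := by
    rw [← Finset.sum_subset (Finset.subset_univ (S x₂' ∪ S x₁')) (fun α _ hα => hzeroB α hα)]
    have hcardU : (((S x₂' ∪ S x₁').card : ℕ) : ℝ) ≤ 2 * m := by
      have h1 : (((S x₂' ∪ S x₁').card : ℕ) : ℝ) ≤ ((S x₂').card : ℝ) + ((S x₁').card : ℝ) := by
        exact_mod_cast Finset.card_union_le _ _
      linarith only [h1, hcard x₂', hcard x₁']
    calc ‖∑ α ∈ S x₂' ∪ S x₁', sB α‖ ≤ ∑ α ∈ S x₂' ∪ S x₁', ‖sB α‖ := norm_sum_le _ _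
      _ ≤ ∑ α ∈ S x₂' ∪ S x₁', BB := Finset.sum_le_sum fun α _ => htermB α
      _ = (S x₂' ∪ S x₁').card * BB := by rw [Finset.sum_const, nsmul_eq_mul]
      _ ≤ 2 * m * BB := mul_le_mul_of_nonneg_right hcardU hBB0
  /- TERM C: the transported difference of the values of `G_α(Δ_μ-source of x₂)` between `x₁` and `x₂`, telescoped along the staircase -/
  have hds_le : ∀ α y, ‖ds x₂ x₂' α y‖ ≤ Λ₁ * F := fun α y =>
    norm_rowSource_sub_le_of_lipschitz hPd hs0 hfit0 hN0 hK₁' hζabs (fun y => hζ1 x₂ y μ) α.1 hx₂ hx₂e hF y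
  set BC : ℝ := c₁ * P.spacing k * Real.exp (-(δ₁ * D' / (P.L : ℝ) ^ k)) * (Λ₁ * F) with hBCdef
  have hBC0 : 0 ≤ BC := by rw [hBCdef]; positivity
  -- the staircase sites: within `T12` of `x₁` and of `x₂`, hence in `Ω₀` at chart depth `≥ R₀ − T12 ≥ L^k`
  have hdeep₂T : ∀ i, T12 ≤ (z₂ i : ℝ) ∧ (z₂ i : ℝ) + T12 ≤ (P.L ^ k * M0 i : ℕ) - 1 := fun i => by
    have h1 := hdeep₂ i
    constructor <;> linarith only [h1.1, h1.2, hnear, hLR₀']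
  have stairDeep : ∀ w : Balaban1983to89.Site P 0, supDist x₂ w ≤ supDist x₁ x₂ →
      (∀ i, (P.L : ℝ) ^ k ≤ (boxCoord hPd (P.L ^ k) c w i : ℝ) ∧ (boxCoord hPd (P.L ^ k) c w i : ℝ) + (P.L : ℝ) ^ k ≤ (P.L ^ k * M0 i : ℕ) - 1) ∧
      B5Ineq137Torus.T P 0 x₂ w ≤ T12 := by
    intro w hw
    have hTw : B5Ineq137Torus.T P 0 x₂ w ≤ T12 := by
      rw [T_eq_supDist P x₂ w, hT12N]; exact_mod_cast hw
    obtain ⟨-, hcoord⟩ := mem_and_abs_sub_le_of_T_le hPd hfit0 hdeep₂T hTw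
    refine ⟨fun i => ?_, hTw⟩
    have h1 := hcoord i
    have h2 := hdeep₂ i
    have h3 : ((|z₂ i - boxCoord hPd (P.L ^ k) c w i| : ℤ) : ℝ) = |((z₂ i : ℤ) : ℝ) - (boxCoord hPd (P.L ^ k) c w i : ℝ)| := by push_cast; rfl
    rw [h3, abs_le] at h1
    constructor <;> linarith only [h1.1, h1.2, h2.1, h2.2, hnear, hLR₀]
  have htermC : ∀ α, ‖sC α‖ ≤ BC * (((d : ℝ) + 1) * T12) := by
    intro α
    by_cases hex : (∃ y, ζ x₂' y * lamFam hPd (P.L ^ k) c M0 s α x₂' y ≠ 0) ∨ (∃ y, ζ x₂ y * lamFam hPd (P.L ^ k) c M0 s α x₂ y ≠ 0)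
    · obtain ⟨hBU, hIntα, hTreeα⟩ := hcube α
      obtain ⟨c', M', hM', hfit', hN', hcα⟩ := cubeFam_fits (hPd := hPd) (s := s) (W := W) hM0 hfit0 hN0 α
      -- the bond bound along the staircase
      have hbond : ∀ (w' : Balaban1983to89.Site P 0) (m' : Fin P.d), supDist x₁ w' ≤ supDist x₁ x₂ → supDist x₂ w' ≤ supDist x₁ x₂ →
          ‖covD P.eps⁻¹ (cfg U) (G α *ᵥ ds x₂ x₂' α) ⟨w', m'⟩‖ ≤ BC := by
        intro w' m' hw1 hw2
        obtain ⟨hdeepw, hTw⟩ := stairDeep w' hw2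
        have hdepth : ∀ v, v ∉ cubeFam hPd (P.L ^ k) c M0 s W α → P.L ^ k ≤ supDist w' v := by
          rcases hex with hex | hex
          · refine depthα α x₂' hx₂e hdeep₂e hex w' hdeepw ?_
            have h1 := B5Ineq137Torus.T_triangle P 0 x₂' x₂ w'; linarith only [h1, hT2'2, hTw]
          · exact depthα α x₂ hx₂ hdeep₂ hex w' hdeepw (by linarith only [hTw])
        have hsuppw : ∀ y, ds x₂ x₂' α y ≠ 0 → D' ≤ B5Ineq137Torus.T P 0 w' y := by
          intro y hy
          refine max_le ?_ (B5Ineq137Torus.T_nonneg P 0 _ y)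
          have h1 := hsupp₁ y (hds_supp x₂ x₂' α y hy)
          have h2 := B5Ineq137Torus.T_triangle P 0 x₁ w' y
          have h3 : B5Ineq137Torus.T P 0 x₁ w' ≤ T12 := by rw [T_eq_supDist P x₁ w', hT12N]; exact_mod_cast hw1
          linarith only [h1, h2, h3]
        have hIntα' := hIntα
        have hTreeα' := hTreeα
        rw [hcα] at hIntα' hTreeα' hdepth
        have key := H1 P hPd hPL k hk1 hkK c' M' hM' hfit' hN' U θp Tu δu hθp0 hplaq hθps hIntα' hTreeα' hsmall w' m' (ds x₂ x₂' α)
          (Λ₁ * F) D' (hds_le α) (hsuppN w' (ds x₂ x₂' α) D' hsuppw) hdepth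
        rw [← hcα] at key
        exact key
      have htel := norm_stairHol_mul_sub_le_of_near U (inv_ne_zero heps.ne') (G α *ᵥ ds x₂ x₂' α) x₁ x₂ hBC0 hbond
      rw [abs_inv, abs_of_pos heps, inv_inv, ← hT12N, hPdR] at htel
      have e : sC α = Ec * (τ * (G α *ᵥ ds x₂ x₂' α) x₂ - (G α *ᵥ ds x₂ x₂' α) x₁) := by simp only [hsCdef]; ring
      rw [e, norm_mul, hEc, hτdef]
      calc P.eps⁻¹ * ‖stairHol U x₁ x₂ * (G α *ᵥ ds x₂ x₂' α) x₂ - (G α *ᵥ ds x₂ x₂' α) x₁‖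
          ≤ P.eps⁻¹ * (P.eps * BC * (((d : ℝ) + 1) * T12)) := mul_le_mul_of_nonneg_left htel (inv_pos.mpr heps).le
        _ = BC * (((d : ℝ) + 1) * T12) := by rw [← mul_assoc, ← mul_assoc P.eps⁻¹, inv_mul_cancel₀ heps.ne', one_mul]
    · push Not at hex
      simp only [hsCdef]
      rw [hds0 x₂ x₂' α (not_exists.2 fun y hy => hy (hex.1 y)) (not_exists.2 fun y hy => hy (hex.2 y))]
      simp only [mulVec_zero, Pi.zero_apply, mul_zero, sub_zero, norm_zero]
      positivity
  have hzeroC : ∀ α, α ∉ S x₂' ∪ S x₂ → sC α = 0 := by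
    intro α hα
    rw [Finset.mem_union, not_or] at hα
    simp only [hsCdef]
    rw [hds0 x₂ x₂' α (fun ⟨y, hy⟩ => hα.1 (hS x₂' hdeep₂e α y hy)) (fun ⟨y, hy⟩ => hα.2 (hS x₂ hdeep₂ α y hy))]
    simp only [mulVec_zero, Pi.zero_apply, mul_zero, sub_zero]
  have hsumC : ‖∑ α, sC α‖ ≤ 2 * m * (BC * (((d : ℝ) + 1) * T12)) := by
    rw [← Finset.sum_subset (Finset.subset_univ (S x₂' ∪ S x₂)) (fun α _ hα => hzeroC α hα)]
    have hcardU : (((S x₂' ∪ S x₂).card : ℕ) : ℝ) ≤ 2 * m := by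
      have h1 : (((S x₂' ∪ S x₂).card : ℕ) : ℝ) ≤ ((S x₂').card : ℝ) + ((S x₂).card : ℝ) := by
        exact_mod_cast Finset.card_union_le _ _
      linarith only [h1, hcard x₂', hcard x₂]
    calc ‖∑ α ∈ S x₂' ∪ S x₂, sC α‖ ≤ ∑ α ∈ S x₂' ∪ S x₂, ‖sC α‖ := norm_sum_le _ _
      _ ≤ ∑ α ∈ S x₂' ∪ S x₂, BC * (((d : ℝ) + 1) * T12) := Finset.sum_le_sum fun α _ => htermC α
      _ = (S x₂' ∪ S x₂).card * (BC * (((d : ℝ) + 1) * T12)) := by rw [Finset.sum_const, nsmul_eq_mul]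
      _ ≤ 2 * m * (BC * (((d : ℝ) + 1) * T12)) := mul_le_mul_of_nonneg_right hcardU (by positivity)
  /- TERM D: p27's (1.10) value member on the difference of the bond-difference sources of `x₂` and `x₁` -/
  set Λ₂ : ℝ := K₂ / (R₀ - R₁) ^ 2 + 4 * Real.pi ^ 2 / (s : ℝ) ^ 2 + 2 * (K₁ / (R₀ - R₁) * (3 * Real.pi * (d + 1 : ℕ) / (2 * s)))
    with hΛ₂def
  have hΛ₂0 : 0 ≤ Λ₂ := by rw [hΛ₂def]; positivity
  set dD : ↥(labels (P.L ^ k) M0 s) → Balaban1983to89.Site P 0 → ℂ := fun α y =>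
    (((ζ x₂' y * lamFam hPd (P.L ^ k) c M0 s α x₂' y - ζ x₂ y * lamFam hPd (P.L ^ k) c M0 s α x₂ y) -
        (ζ x₁' y * lamFam hPd (P.L ^ k) c M0 s α x₁' y - ζ x₁ y * lamFam hPd (P.L ^ k) c M0 s α x₁ y) : ℝ) : ℂ) * f y with hdDdef
  have hdD : ∀ α, ds x₂ x₂' α - ds x₁ x₁' α = dD α := fun α => by
    funext y; simp only [hdsdef, hdDdef, Pi.sub_apply]; push_cast; ring
  have hdD' : ∀ α, G α *ᵥ ds x₂ x₂' α - G α *ᵥ ds x₁ x₁' α = G α *ᵥ dD α := fun α => by rw [← Matrix.mulVec_sub, hdD]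
  have hsD_eq : ∀ α, sD α = Ec * (G α *ᵥ dD α) x₁ := fun α => by
    simp only [hsDdef]; rw [← mul_sub, ← hdD', Pi.sub_apply]
  have hdD_le : ∀ α y, ‖dD α y‖ ≤ Λ₂ * (((d : ℝ) + 1) * T12) * F := by
    intro α y
    have h1 := abs_weight_bondDiff_sub_le_of_hull (hPd := hPd) (c := c) hs0 hfit0 hN0 hζabs hζ1 hζ2 α.1 hz₁ hz₂ hroom₁ hroom₂ μ y
    rw [hxz₁, hxz₂] at h1
    simp only [hdDdef]
    rw [norm_mul, Complex.norm_real, Real.norm_eq_abs]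
    refine mul_le_mul (h1.trans ?_) (hF y) (norm_nonneg _) (by positivity)
    exact mul_le_mul_of_nonneg_left hl1 hΛ₂0
  have hdD_supp : ∀ α y, dD α y ≠ 0 → f y ≠ 0 := fun α y hy => right_ne_zero_of_mul hy
  set BD : ℝ := c₂ * P.spacing k ^ 2 * Real.exp (-(δ₂ * D / (P.L : ℝ) ^ k)) * (Λ₂ * (((d : ℝ) + 1) * T12) * F) with hBDdef
  have hBD0 : 0 ≤ BD := by rw [hBDdef]; positivity
  have htermD : ∀ α, ‖sD α‖ ≤ P.eps⁻¹ * BD := by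
    intro α
    obtain ⟨hBU, hIntα, hTreeα⟩ := hcube α
    obtain ⟨c', M', hM', hfit', hN', hcα⟩ := cubeFam_fits (hPd := hPd) (s := s) (W := W) hM0 hfit0 hN0 α
    rw [hcα] at hIntα hTreeα
    have key := H2 P hPd hPL' k hk1 hkmK c' M' hM' hfit' hN' U Tu δu hIntα hTreeα hsmall x₁ (dD α) (Λ₂ * (((d : ℝ) + 1) * T12) * F) D
      (hdD_le α) (hsuppN x₁ (dD α) D fun y hy => hsupp₁ y (hdD_supp α y hy))
    rw [hsD_eq α, norm_mul, hEc]
    refine mul_le_mul_of_nonneg_left ?_ (inv_pos.mpr heps).le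
    rw [← hcα] at key
    exact key
  have hzeroD : ∀ α, α ∉ (S x₂' ∪ S x₂) ∪ (S x₁' ∪ S x₁) → sD α = 0 := by
    intro α hα
    simp only [Finset.mem_union, not_or] at hα
    simp only [hsDdef]
    rw [hds0 x₂ x₂' α (fun ⟨y, hy⟩ => hα.1.1 (hS x₂' hdeep₂e α y hy)) (fun ⟨y, hy⟩ => hα.1.2 (hS x₂ hdeep₂ α y hy)),
      hds0 x₁ x₁' α (fun ⟨y, hy⟩ => hα.2.1 (hS x₁' hdeep₁e α y hy)) (fun ⟨y, hy⟩ => hα.2.2 (hS x₁ hdeep₁ α y hy))]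
    simp only [mulVec_zero, Pi.zero_apply, mul_zero, sub_self]
  have hsumD : ‖∑ α, sD α‖ ≤ 4 * m * (P.eps⁻¹ * BD) := by
    rw [← Finset.sum_subset (Finset.subset_univ ((S x₂' ∪ S x₂) ∪ (S x₁' ∪ S x₁))) (fun α _ hα => hzeroD α hα)]
    have hcardU : (((((S x₂' ∪ S x₂) ∪ (S x₁' ∪ S x₁)).card : ℕ)) : ℝ) ≤ 4 * m := by
      have h1 : ((((S x₂' ∪ S x₂) ∪ (S x₁' ∪ S x₁)).card : ℕ) : ℝ) ≤ (((S x₂' ∪ S x₂).card : ℕ) : ℝ) + (((S x₁' ∪ S x₁).card : ℕ) : ℝ) := by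
        exact_mod_cast Finset.card_union_le _ _
      have h2 : (((S x₂' ∪ S x₂).card : ℕ) : ℝ) ≤ ((S x₂').card : ℝ) + ((S x₂).card : ℝ) := by exact_mod_cast Finset.card_union_le _ _
      have h3 : (((S x₁' ∪ S x₁).card : ℕ) : ℝ) ≤ ((S x₁').card : ℝ) + ((S x₁).card : ℝ) := by exact_mod_cast Finset.card_union_le _ _
      linarith only [h1, h2, h3, hcard x₂', hcard x₂, hcard x₁', hcard x₁]
    calc ‖∑ α ∈ (S x₂' ∪ S x₂) ∪ (S x₁' ∪ S x₁), sD α‖ ≤ ∑ α ∈ (S x₂' ∪ S x₂) ∪ (S x₁' ∪ S x₁), ‖sD α‖ := norm_sum_le _ _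
      _ ≤ ∑ α ∈ (S x₂' ∪ S x₂) ∪ (S x₁' ∪ S x₁), P.eps⁻¹ * BD := Finset.sum_le_sum fun α _ => htermD α
      _ = ((S x₂' ∪ S x₂) ∪ (S x₁' ∪ S x₁)).card * (P.eps⁻¹ * BD) := by rw [Finset.sum_const, nsmul_eq_mul]
      _ ≤ 4 * m * (P.eps⁻¹ * BD) := mul_le_mul_of_nonneg_right hcardU (by positivity)
  /- ASSEMBLY -/
  have hscale : P.eps⁻¹ * P.spacing k ^ 2 = P.spacing k * (P.L : ℝ) ^ k := by
    rw [Params.spacing]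
    field_simp
  -- the Lipschitz moduli against the bracket: `L^k·Λ₁ ≤ Λ₀·br`, `(L^k)²·Λ₂ ≤ Λ₀₂·br²`
  have hΛ₁le : (P.L : ℝ) ^ k * Λ₁ ≤ Λ₀ * br := by
    have h1 : Λ₁ ≤ Λ₀ * uv := by
      rw [hΛ₁def, huvdef, mul_add]
      refine add_le_add ?_ ?_
      · rw [div_eq_mul_inv]
        exact mul_le_mul_of_nonneg_right (le_max_left _ _) (inv_pos.mpr hgap').le
      · have e : 3 * Real.pi * (d + 1 : ℕ) / (2 * s) = (3 * Real.pi * (d + 1 : ℕ) / 2) * (s : ℝ)⁻¹ := by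
          field_simp
        rw [e]
        exact mul_le_mul_of_nonneg_right (le_max_right _ _) (inv_pos.mpr hsr).le
    calc (P.L : ℝ) ^ k * Λ₁ ≤ (P.L : ℝ) ^ k * (Λ₀ * uv) := mul_le_mul_of_nonneg_left h1 hLk.le
      _ = Λ₀ * ((P.L : ℝ) ^ k * uv) := by ring
      _ ≤ Λ₀ * br := mul_le_mul_of_nonneg_left hLuv hΛ₀0
  have hΛ₂le : ((P.L : ℝ) ^ k) ^ 2 * Λ₂ ≤ Λ₀₂ * br ^ 2 := by
    have hu : 0 ≤ (R₀ - R₁)⁻¹ := (inv_pos.mpr hgap').le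
    have hv : 0 ≤ (s : ℝ)⁻¹ := (inv_pos.mpr hsr).le
    have h1 : Λ₂ ≤ Λ₀₂ * uv ^ 2 := by
      rw [hΛ₂def, hΛ₀₂def, huvdef]
      have e1 : K₂ / (R₀ - R₁) ^ 2 = K₂ * ((R₀ - R₁)⁻¹) ^ 2 := by rw [div_eq_mul_inv, inv_pow]
      have e2 : 4 * Real.pi ^ 2 / (s : ℝ) ^ 2 = 4 * Real.pi ^ 2 * ((s : ℝ)⁻¹) ^ 2 := by rw [div_eq_mul_inv, inv_pow]
      have e3 : 2 * (K₁ / (R₀ - R₁) * (3 * Real.pi * (d + 1 : ℕ) / (2 * s))) =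
          3 * Real.pi * (d + 1 : ℕ) * K₁ * ((R₀ - R₁)⁻¹ * (s : ℝ)⁻¹) := by
        rw [div_eq_mul_inv, div_eq_mul_inv, mul_inv]
        ring
      rw [e1, e2, e3]
      have hq1 : ((R₀ - R₁)⁻¹) ^ 2 ≤ ((R₀ - R₁)⁻¹ + (s : ℝ)⁻¹) ^ 2 := pow_le_pow_left₀ hu (le_add_of_nonneg_right hv) 2
      have hq2 : ((s : ℝ)⁻¹) ^ 2 ≤ ((R₀ - R₁)⁻¹ + (s : ℝ)⁻¹) ^ 2 := pow_le_pow_left₀ hv (le_add_of_nonneg_left hu) 2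
      have hq3 : (R₀ - R₁)⁻¹ * (s : ℝ)⁻¹ ≤ ((R₀ - R₁)⁻¹ + (s : ℝ)⁻¹) ^ 2 := by
        have e : ((R₀ - R₁)⁻¹ + (s : ℝ)⁻¹) ^ 2 =
            (R₀ - R₁)⁻¹ * (s : ℝ)⁻¹ + (((R₀ - R₁)⁻¹) ^ 2 + (R₀ - R₁)⁻¹ * (s : ℝ)⁻¹ + ((s : ℝ)⁻¹) ^ 2) := by ring
        rw [e]
        exact le_add_of_nonneg_right (by positivity)
      have hπ : 0 ≤ 4 * Real.pi ^ 2 := by positivity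
      have hπK : 0 ≤ 3 * Real.pi * (d + 1 : ℕ) * K₁ := by positivity
      calc K₂ * ((R₀ - R₁)⁻¹) ^ 2 + 4 * Real.pi ^ 2 * ((s : ℝ)⁻¹) ^ 2 + 3 * Real.pi * (d + 1 : ℕ) * K₁ * ((R₀ - R₁)⁻¹ * (s : ℝ)⁻¹)
          ≤ K₂ * ((R₀ - R₁)⁻¹ + (s : ℝ)⁻¹) ^ 2 + 4 * Real.pi ^ 2 * ((R₀ - R₁)⁻¹ + (s : ℝ)⁻¹) ^ 2 +
            3 * Real.pi * (d + 1 : ℕ) * K₁ * ((R₀ - R₁)⁻¹ + (s : ℝ)⁻¹) ^ 2 :=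
            add_le_add (add_le_add (mul_le_mul_of_nonneg_left hq1 hK₂) (mul_le_mul_of_nonneg_left hq2 hπ))
              (mul_le_mul_of_nonneg_left hq3 hπK)
        _ = (K₂ + 4 * Real.pi ^ 2 + 3 * Real.pi * (d + 1 : ℕ) * K₁) * ((R₀ - R₁)⁻¹ + (s : ℝ)⁻¹) ^ 2 := by ring
    calc ((P.L : ℝ) ^ k) ^ 2 * Λ₂ ≤ ((P.L : ℝ) ^ k) ^ 2 * (Λ₀₂ * uv ^ 2) := mul_le_mul_of_nonneg_left h1 (by positivity)
      _ = Λ₀₂ * ((P.L : ℝ) ^ k * uv) ^ 2 := by ring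
      _ ≤ Λ₀₂ * br ^ 2 := mul_le_mul_of_nonneg_left (pow_le_pow_left₀ (by positivity) hLuv 2) hΛ₀₂0
  -- the four terms in the common shape `spacing·(C_T·m·br²·Ex·F)`
  have hA : w * ‖∑ α, sA α‖ ≤ P.spacing k * (cH * m * br ^ 2 * Ex * F) := by
    refine hsumA.trans ?_
    rw [hBAdef]
    have h1 : cH * Real.exp (-(δH * (((P.L : ℝ) ^ k)⁻¹ * D))) * F ≤ cH * Ex * F :=
      mul_le_mul_of_nonneg_right (mul_le_mul_of_nonneg_left hEH hcH.le) hF0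
    have h2 : 1 ≤ br ^ 2 := hbr1.trans hbr2
    calc m * (P.spacing k * (cH * Real.exp (-(δH * (((P.L : ℝ) ^ k)⁻¹ * D))) * F)) ≤ m * (P.spacing k * (cH * Ex * F)) :=
          mul_le_mul_of_nonneg_left (mul_le_mul_of_nonneg_left h1 hsp0.le) hm0
      _ = P.spacing k * (cH * m * 1 * Ex * F) := by ring
      _ ≤ P.spacing k * (cH * m * br ^ 2 * Ex * F) := by
          refine mul_le_mul_of_nonneg_left ?_ hsp0.le
          exact mul_le_mul_of_nonneg_right (mul_le_mul_of_nonneg_right (mul_le_mul_of_nonneg_left h2 (by positivity)) hE0.le) hF0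
  have hB : w * ‖∑ α, sB α‖ ≤ P.spacing k * (CB * m * br ^ 2 * Ex * F) := by
    have h1 : w * ‖∑ α, sB α‖ ≤ w * (2 * m * BB) := mul_le_mul_of_nonneg_left hsumB hw0
    refine h1.trans ?_
    have e : w * (2 * m * BB) =
        (w * T12) * Λ₁ * (P.spacing k * (2 * ((d : ℝ) + 1) * c₁ * m * Real.exp (-(δ₁ * D / (P.L : ℝ) ^ k)) * F)) := by
      rw [hBBdef]; ring
    rw [e]
    have h2 : (w * T12) * Λ₁ ≤ Λ₀ * br :=
      le_trans (mul_le_mul_of_nonneg_right hwT hΛ₁0) hΛ₁le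
    have h3 : P.spacing k * (2 * ((d : ℝ) + 1) * c₁ * m * Real.exp (-(δ₁ * D / (P.L : ℝ) ^ k)) * F) ≤
        P.spacing k * (2 * ((d : ℝ) + 1) * c₁ * m * Ex * F) :=
      mul_le_mul_of_nonneg_left (mul_le_mul_of_nonneg_right (mul_le_mul_of_nonneg_left hE1 (by positivity)) hF0) hsp0.le
    calc (w * T12) * Λ₁ * (P.spacing k * (2 * ((d : ℝ) + 1) * c₁ * m * Real.exp (-(δ₁ * D / (P.L : ℝ) ^ k)) * F))
        ≤ (Λ₀ * br) * (P.spacing k * (2 * ((d : ℝ) + 1) * c₁ * m * Ex * F)) :=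
          mul_le_mul h2 h3 (by positivity) (by positivity)
      _ = P.spacing k * (CB * m * br * Ex * F) := by rw [hCBdef]; ring
      _ ≤ P.spacing k * (CB * m * br ^ 2 * Ex * F) := by
          refine mul_le_mul_of_nonneg_left ?_ hsp0.le
          exact mul_le_mul_of_nonneg_right (mul_le_mul_of_nonneg_right (mul_le_mul_of_nonneg_left hbr2 (mul_nonneg hCB0 hm0)) hE0.le) hF0
  have hC : w * ‖∑ α, sC α‖ ≤ P.spacing k * (CC * m * br ^ 2 * Ex * F) := by
    have h1 : w * ‖∑ α, sC α‖ ≤ w * (2 * m * (BC * (((d : ℝ) + 1) * T12))) := mul_le_mul_of_nonneg_left hsumC hw0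
    refine h1.trans ?_
    have e : w * (2 * m * (BC * (((d : ℝ) + 1) * T12))) =
        (w * T12) * Λ₁ * (P.spacing k * (2 * ((d : ℝ) + 1) * c₁ * m * Real.exp (-(δ₁ * D' / (P.L : ℝ) ^ k)) * F)) := by
      rw [hBCdef]; ring
    rw [e]
    have h2 : (w * T12) * Λ₁ ≤ Λ₀ * br :=
      le_trans (mul_le_mul_of_nonneg_right hwT hΛ₁0) hΛ₁le
    have h3 : P.spacing k * (2 * ((d : ℝ) + 1) * c₁ * m * Real.exp (-(δ₁ * D' / (P.L : ℝ) ^ k)) * F) ≤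
        P.spacing k * (2 * ((d : ℝ) + 1) * c₁ * m * (Real.exp δ₁ * Ex) * F) :=
      mul_le_mul_of_nonneg_left (mul_le_mul_of_nonneg_right (mul_le_mul_of_nonneg_left hexpD' (by positivity)) hF0) hsp0.le
    calc (w * T12) * Λ₁ * (P.spacing k * (2 * ((d : ℝ) + 1) * c₁ * m * Real.exp (-(δ₁ * D' / (P.L : ℝ) ^ k)) * F))
        ≤ (Λ₀ * br) * (P.spacing k * (2 * ((d : ℝ) + 1) * c₁ * m * (Real.exp δ₁ * Ex) * F)) :=
          mul_le_mul h2 h3 (by positivity) (by positivity)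
      _ = P.spacing k * (CC * m * br * Ex * F) := by rw [hCCdef]; ring
      _ ≤ P.spacing k * (CC * m * br ^ 2 * Ex * F) := by
          refine mul_le_mul_of_nonneg_left ?_ hsp0.le
          exact mul_le_mul_of_nonneg_right (mul_le_mul_of_nonneg_right (mul_le_mul_of_nonneg_left hbr2 (mul_nonneg hCC0 hm0)) hE0.le) hF0
  have hDt : w * ‖∑ α, sD α‖ ≤ P.spacing k * (CD * m * br ^ 2 * Ex * F) := by
    have h1 : w * ‖∑ α, sD α‖ ≤ w * (4 * m * (P.eps⁻¹ * BD)) := mul_le_mul_of_nonneg_left hsumD hw0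
    refine h1.trans ?_
    have e : w * (4 * m * (P.eps⁻¹ * BD)) =
        (w * T12) * ((P.eps⁻¹ * P.spacing k ^ 2) * (4 * ((d : ℝ) + 1) * c₂ * m * Λ₂ * Real.exp (-(δ₂ * D / (P.L : ℝ) ^ k)) * F)) := by
      rw [hBDdef]; ring
    rw [e, hscale]
    have e2 : (w * T12) * (P.spacing k * (P.L : ℝ) ^ k * (4 * ((d : ℝ) + 1) * c₂ * m * Λ₂ * Real.exp (-(δ₂ * D / (P.L : ℝ) ^ k)) * F)) =
        ((w * T12) * ((P.L : ℝ) ^ k * Λ₂)) * (P.spacing k * (4 * ((d : ℝ) + 1) * c₂ * m * Real.exp (-(δ₂ * D / (P.L : ℝ) ^ k)) * F)) := by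
      ring
    rw [e2]
    have h2 : (w * T12) * ((P.L : ℝ) ^ k * Λ₂) ≤ Λ₀₂ * br ^ 2 := by
      calc (w * T12) * ((P.L : ℝ) ^ k * Λ₂) ≤ (P.L : ℝ) ^ k * ((P.L : ℝ) ^ k * Λ₂) := mul_le_mul_of_nonneg_right hwT (by positivity)
        _ = ((P.L : ℝ) ^ k) ^ 2 * Λ₂ := by ring
        _ ≤ Λ₀₂ * br ^ 2 := hΛ₂le
    have h3 : P.spacing k * (4 * ((d : ℝ) + 1) * c₂ * m * Real.exp (-(δ₂ * D / (P.L : ℝ) ^ k)) * F) ≤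
        P.spacing k * (4 * ((d : ℝ) + 1) * c₂ * m * Ex * F) :=
      mul_le_mul_of_nonneg_left (mul_le_mul_of_nonneg_right (mul_le_mul_of_nonneg_left hE2 (by positivity)) hF0) hsp0.le
    calc ((w * T12) * ((P.L : ℝ) ^ k * Λ₂)) * (P.spacing k * (4 * ((d : ℝ) + 1) * c₂ * m * Real.exp (-(δ₂ * D / (P.L : ℝ) ^ k)) * F))
        ≤ (Λ₀₂ * br ^ 2) * (P.spacing k * (4 * ((d : ℝ) + 1) * c₂ * m * Ex * F)) :=
          mul_le_mul h2 h3 (by positivity) (by positivity)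
      _ = P.spacing k * (CD * m * br ^ 2 * Ex * F) := by rw [hCDdef]; ring
  -- conclusion
  have hsplit : ‖(∑ α, sA α + ∑ α, sB α) + (∑ α, sC α + ∑ α, sD α)‖ ≤
      ‖∑ α, sA α‖ + ‖∑ α, sB α‖ + (‖∑ α, sC α‖ + ‖∑ α, sD α‖) :=
    (norm_add_le _ _).trans (add_le_add (norm_add_le _ _) (norm_add_le _ _))
  have hCsum : cH + CB + CC + CD ≤ C := by rw [hCdef]; linarith only [hcg.le]
  calc w * ‖τ * (∑ α, covD P.eps⁻¹ (cfg U) (G α *ᵥ gs x₂' α) ⟨x₂, μ⟩ + ∑ α, Ec * (G α *ᵥ ds x₂ x₂' α) x₂) -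
        (∑ α, covD P.eps⁻¹ (cfg U) (G α *ᵥ gs x₁' α) ⟨x₁, μ⟩ + ∑ α, Ec * (G α *ᵥ ds x₁ x₁' α) x₁)‖
      = w * ‖(∑ α, sA α + ∑ α, sB α) + (∑ α, sC α + ∑ α, sD α)‖ := by rw [hdecomp]
    _ ≤ w * (‖∑ α, sA α‖ + ‖∑ α, sB α‖ + (‖∑ α, sC α‖ + ‖∑ α, sD α‖)) := mul_le_mul_of_nonneg_left hsplit hw0
    _ = w * ‖∑ α, sA α‖ + w * ‖∑ α, sB α‖ + (w * ‖∑ α, sC α‖ + w * ‖∑ α, sD α‖) := by ring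
    _ ≤ P.spacing k * (cH * m * br ^ 2 * Ex * F) + P.spacing k * (CB * m * br ^ 2 * Ex * F) +
          (P.spacing k * (CC * m * br ^ 2 * Ex * F) + P.spacing k * (CD * m * br ^ 2 * Ex * F)) :=
        add_le_add (add_le_add hA hB) (add_le_add hC hDt)
    _ = P.spacing k * ((cH + CB + CC + CD) * m * br ^ 2 * Ex * F) := by ring
    _ ≤ P.spacing k * (C * m * br ^ 2 * Ex * F) := by
        refine mul_le_mul_of_nonneg_left ?_ hsp0.le
        exact mul_le_mul_of_nonneg_right (mul_le_mul_of_nonneg_right (mul_le_mul_of_nonneg_right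
          (mul_le_mul_of_nonneg_right hCsum hm0) (by positivity)) hE0.le) hF0

end DerivHolder

/-! ## §4 The member for the smooth product cut-off `ζ″ = ζ^Π(R₁, R₀)` of (2.29) -/

section ZetaPiMember

open BIJ85BlockAveragesTorus BIJ85BlockAveragesTorusK
open BIJ88DeltaLoc234Torus (gLocT)
open BIJ88NeumannPropagatorFlatDecayCube
open BIJ88LocWeights227Torus
open BIJ88LocDeriv230ZetaPiFlatTorus (zetaPi_zero_eq_zero_of_le abs_zetaPi_zero_le_one abs_zetaPi_zero_shift_sub_le abs_zetaPi_zero_secondDiff_le)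
open BIJ88HkLocHolderTorus (zetaPi secondDiffConst)
open Literature.Analysis.Calculus (exists_abs_deriv_and_deriv_deriv_smoothTransition_le)

variable {d : ℕ}

/-- **THE HÖLDER MEMBER OF ORDER `1 + θ` OF (2.30) AT NON-FLAT SMALL FIELDS FOR `G_{k,loc}(u)` BUILT FROM THE TORUS CUBES AND WEIGHTS OF
RECORD AND THE SMOOTH PRODUCT CUT-OFF `ζ″ = ζ^Π(R₁, R₀)`** (print p. 263: *"ζ_k(x₁, x₂) is a smooth function of x₁ − x₂"*, *"Bounds analogous
to (2.30) … hold for covariant derivatives and Hölder derivatives of G_{k,loc}(u) of order less than two"*): for `d + 1 ∈ {2,3}`, `L` odd `> 1`,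
`a > 0` and every `0 ≤ θ < 1` THERE EXIST `t₀, c₀ > 0` depending on `(d, L, a, θ)` and the universal profile bound `C_σ` only such that, for all
data as in `derivHolder230_smallField_of_smooth` with `1 ≤ R₁ < R₀ ≤ (|T^{(0)}| − 3)/2`,
`(L^k/|x₁ − x₂|_T)^θ·‖U(Γ_{x₁,x₂})(D_uG_{k,loc}(u)f)(x₂, μ) − (D_uG_{k,loc}(u)f)(x₁, μ)‖ ≤ (L^kε)·c₀·m·(1 + L^k((R₀ − R₁)⁻¹ + s⁻¹))²·e^{−t₀D/L^k}·F`.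
[cite: BalabanImbrieJaffe1988, (2.30) p.263] [cite: Balaban1983RegularityDecay, Theorem p.573 (1.9)] -/
theorem derivHolder230_smallField_zetaPi (d L : ℕ) (hd1 : 1 ≤ d) (hd3 : d + 1 ≤ 3) (hL : Odd L ∧ 1 < L) {a : ℝ} (ha : 0 < a)
    {θ : ℝ} (hθ0 : 0 ≤ θ) (hθ1 : θ < 1) :
    ∃ t₀ c₀ : ℝ, 0 < t₀ ∧ 0 < c₀ ∧ ∀ (P : Params) (hPd : P.d = d + 1), P.L = L →
      ∀ k : ℕ, 1 ≤ k → k ≤ P.K → ∀ (c M0 : Fin (d + 1) → ℕ), (∀ i, 1 ≤ M0 i) →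
        (∀ i, c i * P.L ^ k + P.L ^ k * M0 i ≤ P.sitesPerDir 0) → (∀ i, P.L ^ k * M0 i < P.sitesPerDir 0) →
      ∀ (s W : ℕ), 1 ≤ s → ∀ (R R₀ R₁ : ℝ), 4 * (P.L : ℝ) ^ k + 1 < R → 1 ≤ R₁ → R₁ < R₀ → R₀ ≤ ((P.sitesPerDir 0 : ℝ) - 3) / 2 →
        3 * (P.L : ℝ) ^ k ≤ R₀ → 2 * (s : ℝ) / 3 + R₀ / 2 + R ≤ W → (∀ i, ((P.L ^ k * M0 i : ℕ) : ℝ) + R ≤ P.sitesPerDir 0) →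
      ∀ (U : GaugeField P 0 U1) (θp Tu δu : ℝ), 0 ≤ θp →
        (∀ p : Balaban1983to89.Plaq P 0, ‖toC (GaugeField.plaqHol U p) - 1‖ ≤ θp) →
        2 * (P.d : ℝ) ^ 3 * (((P.L : ℝ) ^ k) ^ 2 * θp) ^ 2 ≤ 1 →
        (∀ b ∈ starB (cubeT hPd (P.L ^ k) c fun i => P.L ^ k * M0 i), blkIter k b.src = blkIter k b.tgt → ‖toC (U b) - 1‖ ≤ Tu) →
        (∀ x ∈ (cubeT hPd (P.L ^ k) c fun i => P.L ^ k * M0 i), ‖holCK U k x - 1‖ ≤ δu) →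
        2 * (((P.L : ℝ) ^ k - 1) * (P.L : ℝ) ^ k) * P.d * Tu ^ 2 + 2 * δu ^ 2 ≤ 1 / 2 →
      ∀ (x₁ x₂ : Balaban1983to89.Site P 0) (μ : Fin P.d),
        x₁ ∈ (cubeT hPd (P.L ^ k) c fun i => P.L ^ k * M0 i) →
        (∀ i, R₀ ≤ (boxCoord hPd (P.L ^ k) c x₁ i : ℝ) ∧ (boxCoord hPd (P.L ^ k) c x₁ i : ℝ) + R₀ ≤ (P.L ^ k * M0 i : ℕ) - 1) →
        x₁.shift μ ∈ (cubeT hPd (P.L ^ k) c fun i => P.L ^ k * M0 i) →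
        (∀ i, R₀ ≤ (boxCoord hPd (P.L ^ k) c (x₁.shift μ) i : ℝ) ∧
          (boxCoord hPd (P.L ^ k) c (x₁.shift μ) i : ℝ) + R₀ ≤ (P.L ^ k * M0 i : ℕ) - 1) →
        x₂ ∈ (cubeT hPd (P.L ^ k) c fun i => P.L ^ k * M0 i) →
        (∀ i, R₀ ≤ (boxCoord hPd (P.L ^ k) c x₂ i : ℝ) ∧ (boxCoord hPd (P.L ^ k) c x₂ i : ℝ) + R₀ ≤ (P.L ^ k * M0 i : ℕ) - 1) →
        x₂.shift μ ∈ (cubeT hPd (P.L ^ k) c fun i => P.L ^ k * M0 i) →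
        (∀ i, R₀ ≤ (boxCoord hPd (P.L ^ k) c (x₂.shift μ) i : ℝ) ∧
          (boxCoord hPd (P.L ^ k) c (x₂.shift μ) i : ℝ) + R₀ ≤ (P.L ^ k * M0 i : ℕ) - 1) →
      ∀ (f : Balaban1983to89.Site P 0 → ℂ) (F D : ℝ), (∀ y, ‖f y‖ ≤ F) → 0 ≤ D →
        (∀ y, f y ≠ 0 → D ≤ B5Ineq137Torus.T P 0 x₁ y) → (∀ y, f y ≠ 0 → D ≤ B5Ineq137Torus.T P 0 x₂ y) →
        ((P.L : ℝ) ^ k / B5Ineq137Torus.T P 0 x₁ x₂) ^ θ *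
          ‖stairHol U x₁ x₂ *
              covD P.eps⁻¹ (cfg U)
                (gLocT (B1RG242Torus.α P a k * (P.L : ℝ) ^ (k * P.d)) P.eps⁻¹ U k
                  (cubeFam hPd (P.L ^ k) c M0 s W) (lamFam hPd (P.L ^ k) c M0 s) (zetaPi R₁ R₀ 0) *ᵥ f) ⟨x₂, μ⟩ -
            covD P.eps⁻¹ (cfg U)
                (gLocT (B1RG242Torus.α P a k * (P.L : ℝ) ^ (k * P.d)) P.eps⁻¹ U k
                  (cubeFam hPd (P.L ^ k) c M0 s W) (lamFam hPd (P.L ^ k) c M0 s) (zetaPi R₁ R₀ 0) *ᵥ f) ⟨x₁, μ⟩‖ ≤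
          P.spacing k * (c₀ * (⌊(((P.L : ℝ) ^ k) - 1 + R₀) / s⌋₊ + 3) ^ (d + 1) *
            (1 + (P.L : ℝ) ^ k * ((R₀ - R₁)⁻¹ + (s : ℝ)⁻¹)) ^ 2 * Real.exp (-(t₀ * (((P.L : ℝ) ^ k)⁻¹ * D))) * F) := by
  obtain ⟨C, hC0, hC1, hC2⟩ := exists_abs_deriv_and_deriv_deriv_smoothTransition_le
  have hK₂ : 0 ≤ C ^ 2 + C := by positivity
  obtain ⟨t₀, c₀, ht₀, hc₀, H⟩ := derivHolder230_smallField_of_smooth d L hd1 hd3 hL ha hθ0 hθ1 hC0 hK₂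
  refine ⟨t₀, c₀, ht₀, hc₀, ?_⟩
  intro P hPd hPL k hk1 hkK c M0 hM0 hfit0 hN0 s W hs R R₀ R₁ hR hR₁ hR10 hR₀N hLR₀ hW hgap U θp Tu δu hθp0 hplaq hθps hInt hTree hsmall
    x₁ x₂ μ hx₁ hdeep₁ hx₁e hdeep₁e hx₂ hdeep₂ hx₂e hdeep₂e f F D hF hD hsupp₁ hsupp₂
  have e : secondDiffConst C R₁ R₀ = (C ^ 2 + C) / (R₀ - R₁) ^ 2 := by rw [secondDiffConst, div_pow, add_div]
  exact H P hPd hPL k hk1 hkK c M0 hM0 hfit0 hN0 s W hs R R₀ R₁ hR (zero_le_one.trans hR₁) hR10 hLR₀ hW hgap (zetaPi R₁ R₀ 0)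
    (abs_zetaPi_zero_le_one R₁ R₀) (zetaPi_zero_eq_zero_of_le hR10) (abs_zetaPi_zero_shift_sub_le hC1 hR10)
    (fun x y κ ν => (abs_zetaPi_zero_secondDiff_le hC1 hC2 hR10 hR₁ hR₀N x y κ ν).trans_eq e)
    U θp Tu δu hθp0 hplaq hθps hInt hTree hsmall x₁ x₂ μ hx₁ hdeep₁ hx₁e hdeep₁e hx₂ hdeep₂ hx₂e hdeep₂e f F D hF hD hsupp₁ hsupp₂

end ZetaPiMember

end

end Literature.MathematicalPhysics.QuantumFieldTheory.BalabanImbrieJaffe1984to88.BIJ88LocDerivHolder230SmallFieldTorus
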